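import Literature.Computability.Complexity.HardcoreInapproximabilityTrees
import HarnessLib

/-!
# The hard-core model on the complete `(d-1)`-ary tree — Part II/III: contraction in logit
# coordinates, the Markov cut, Chernoff bounds, rates, and Sly's Lemma 4.2 for every `λ > λ_c`

Continuation of `HardcoreInapproximabilityTrees.lean` (Sly 2010, §4). Theorems only.

* **Contraction in logit coordinates (all `λ`)**: in logits the recursion is additive,
  `logit Φ(x) = log λ + Σ_c log(1-x_c)` (`hcLogit_hcStep`), and one level contracts in `ℓ¹` by the
  largest input value (`abs_log_one_sub_le_mul_abs_logit`, `hcLogit_hcStep_contract`), so `L` levels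
  contract by `ρ^L`, `ρ = max(hi, λ/(1+λ))` (`hcLogit_hcIter_contract`; back to probabilities by
  `abs_sub_le_half_abs_logit`, `abs_logit_sub_le`) — a replacement for Sly's `3/4`-step (which needs
  `q⁺ ≤ 3/5`) valid for every `λ > 0`.
* **The Markov property of the recursion** at level `L` (`hcTreeZ_cut`, weighted form `hcGen_cut`:
  "by the Markov property … the elements of `𝒳_{L,ℓ,s}` are conditionally independent given
  `ξ_{ρ,L}`"), the **exponential moment** of the subtree deviations under the root-conditioned measures
  (`hcGen_expMoment_le`, via `e^t ≤ 1 + (e-1)t`), its product over the `q^L` subtrees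
  (`hcGen_expMoment_total_le`), the **Chernoff bound** `hcConc_tail`, the deterministic link
  `hcTreeX_dev_lt_of_sum_lt`, and **Lemma 4.2 in finite form with free parameters** `hcConc_main`:
  `ν{A : |X_{K+L}(A) - R_{K+L}| ≥ ½ρ^L C T} ≤ e^{-cT}(1 + (e-1)c E_ν|X_K - R_K|/p)^{q^L}`.
* **Rates**: deviations from the lower envelope (`sum_abs_sub_mean_le'`, `hcTreeX_meanAbsDev_le'`),
  explicit Lipschitz bounds for `φ` (`hcPhi_lipschitz_on`, `hcPhi_lipschitz`), **geometric convergence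
  of the envelopes to the two-cycle** from its strict attraction (`hcEnv_geometric`, via
  `geometric_decay` and `hcEnv_eventually`), hence `E_ν|X_K - R_K| ≤ 2(1+λq) C κ^{⌊K/2⌋}` at the cycle
  fugacities (`hcTreeX_meanAbsDev_decay`, `iterate_two_cycle`), the parameter book-keeping
  `lemma42_parameters` (Sly's `L = ⌊rℓ⌋`, `τ`, `ζ₁`, `ζ₂`), and
* **`sly_lemma42` — Sly's Lemma 4.2 for every `λ > λ_c(𝕋_d)`**: for `d ≥ 3`, the two-cycle
  `0 < q⁻ < q⁺ < 1` and the boundary fugacity `w` with `w/(1+w) ∈ {q⁺, q⁻}`, there are `ζ₁, ζ₂ > 0` with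
  `ν_ℓ{A : |X_ℓ(A) - R_ℓ| ≥ e^{-ζ₁ℓ}} ≤ exp(-e^{ζ₂ℓ})` for all large `ℓ` (`R_ℓ = φ^ℓ(w/(1+w)) ∈ {q⁺,q⁻}`)
  — WITHOUT Sly's extra conditions `q⁺ ≤ 3/5`, `(d-1)q⁺q⁻ < 1`.

Not here: Lemma 4.3's identification for the gadget's forests (`slyForestZ`) and the assembly of
(GpropB).

## References

* A. Sly, *Computational transition at the uniqueness threshold*, FOCS 2010, arXiv:1005.5584: §4
  (Lemma 4.1, eqs. (e:treeReconDecay2), (e:onePointCorrelations), (e:conditionalExpectedL1); Lemma 4.2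
  and its proof: the choice of `r`, `L = ⌊rℓ⌋`, `ζ₁`, `ζ₂`, Markov's inequality display) [Sly2010].
-/

namespace Literature.Computability.Complexity

open Finset

section TreeRecursionConc

variable {q : ℕ} {lam : ℝ}

/-! ### Part II (towards Lemma 4.2 for all `λ`): contraction in logit coordinates -/

section LogitContraction

/-- **The recursion is additive in logit/log coordinates**: `logit Φ(x) = log λ + Σ_c log(1 - x_c)`
(`Φ/(1-Φ) = λ Π (1 - x_c)`). [folklore] -/
theorem hcLogit_hcStep (hlam : 0 < lam) (x : Fin q → ℝ) (hx : ∀ c, x c < 1) :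
    hcLogit (hcStep q lam x) = Real.log lam + ∑ c, Real.log (1 - x c) := by
  have hP : 0 < lam * ∏ c, (1 - x c) := mul_pos hlam (prod_pos fun c _ => by linarith [hx c])
  unfold hcLogit hcStep
  set P : ℝ := lam * ∏ c, (1 - x c) with hPdef
  have e : P / (1 + P) / (1 - P / (1 + P)) = P := by
    have h1 : (1 + P) ≠ 0 := by linarith
    field_simp
    ring
  rw [e, hPdef, Real.log_mul hlam.ne' (prod_pos fun c _ => by linarith [hx c]).ne',
    Real.log_prod (fun c _ => (by linarith [hx c] : (1 - x c) ≠ 0))]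

/-- **One coordinate contracts by the occupation bound**: for `x, x' ∈ (0, hi]`, `hi < 1`,
`|log(1-x) - log(1-x')| ≤ hi · |logit x - logit x'|` (the derivative of `y ↦ log(1+e^y)` is the
occupation probability `σ(y) ≤ hi`; here from `1 - 1/u ≤ log u ≤ u - 1`). [folklore] -/
theorem abs_log_one_sub_le_mul_abs_logit {x x' hi : ℝ} (hx0 : 0 < x) (hxh : x ≤ hi) (hx0' : 0 < x')
    (hxh' : x' ≤ hi) (hhi : hi < 1) :
    |Real.log (1 - x) - Real.log (1 - x')| ≤ hi * |hcLogit x - hcLogit x'| := by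
  -- reduce to `x < x'` by symmetry
  wlog hlt : x ≤ x' generalizing x x'
  · have h := this hx0' hxh' hx0 hxh (le_of_not_ge hlt)
    rwa [abs_sub_comm, abs_sub_comm (hcLogit x')] at h
  have hx1 : x < 1 := by linarith
  have hx1' : x' < 1 := by linarith
  rw [hcLogit_eq hx0 hx1, hcLogit_eq hx0' hx1']
  -- both differences are nonnegative for `x ≤ x'`
  have hA : 0 ≤ Real.log (1 - x) - Real.log (1 - x') :=
    sub_nonneg.2 (Real.log_le_log (by linarith) (by linarith))
  have hB : 0 ≤ Real.log x' - Real.log x := sub_nonneg.2 (Real.log_le_log hx0 hlt)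
  rw [abs_of_nonneg hA, show Real.log x - Real.log (1 - x) - (Real.log x' - Real.log (1 - x')) =
    -((Real.log x' - Real.log x) + (Real.log (1 - x) - Real.log (1 - x'))) by ring, abs_neg,
    abs_of_nonneg (add_nonneg hB hA)]
  -- `log(1-x) - log(1-x') ≥ (x'-x)/(1-x)` and `log x' - log x ≤ (x'-x)/x`
  have hne : (1 - x) ≠ 0 := by linarith
  have hne' : (1 - x') ≠ 0 := by linarith
  have hx0ne : x' ≠ 0 := hx0'.ne'
  have h1 : (x' - x) / (1 - x) ≤ Real.log (1 - x) - Real.log (1 - x') := by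
    have := Real.one_sub_inv_le_log_of_pos (show 0 < (1 - x) / (1 - x') by apply div_pos <;> linarith)
    rw [Real.log_div (by linarith) (by linarith)] at this
    rw [inv_div] at this
    have e : 1 - (1 - x') / (1 - x) = (x' - x) / (1 - x) := by field_simp; ring
    linarith
  -- it suffices that `(1-hi)·A ≤ hi·B` where `A = log(1-x)-log(1-x') ≥ 0`; we show `A ≤ hi (A + B)`
  -- via `(1 - hi) A ≤ (1-hi) ... `: use `A ≥ (x'-x)/(1-x)` only through `B`-free algebra:
  have h2 : Real.log x' - Real.log x ≥ 0 := hB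
  -- `(1 - hi) (log(1-x) - log(1-x')) ≤ hi (log x' - log x)` : from `log(1-x)-log(1-x') ≤ (x'-x)/(1-x')`
  -- and `log x' - log x ≥ (x'-x)/x'`
  have h3 : Real.log (1 - x) - Real.log (1 - x') ≤ (x' - x) / (1 - x') := by
    have := Real.log_le_sub_one_of_pos (show 0 < (1 - x) / (1 - x') by apply div_pos <;> linarith)
    rw [Real.log_div (by linarith) (by linarith)] at this
    have e : (1 - x) / (1 - x') - 1 = (x' - x) / (1 - x') := by field_simp; ring
    linarith
  have h4 : (x' - x) / x' ≤ Real.log x' - Real.log x := by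
    have := Real.one_sub_inv_le_log_of_pos (div_pos hx0' hx0)
    rw [Real.log_div hx0'.ne' hx0.ne', inv_div] at this
    have e : 1 - x / x' = (x' - x) / x' := by field_simp
    linarith
  -- `(1-hi)(x'-x)/(1-x') ≤ hi (x'-x)/x'` since `x' ≤ hi`, `1 - x' ≥ 1 - hi`
  have hxx : 0 ≤ x' - x := by linarith
  have h5 : (1 - hi) * ((x' - x) / (1 - x')) ≤ hi * ((x' - x) / x') := by
    rw [mul_div_assoc', mul_div_assoc', div_le_div_iff₀ (by linarith) hx0']
    nlinarith [mul_nonneg hxx (by linarith : (0:ℝ) ≤ hi - x'), mul_nonneg hxx hx0'.le]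
  nlinarith [h3, h4, h5, mul_nonneg (by linarith : (0:ℝ) ≤ 1 - hi) hA]

/-- **`Φ` contracts in logit coordinates by the occupation bound**: for `x, x' ∈ (0, hi]^q`, `hi < 1`,
`|logit Φ(x) - logit Φ(x')| ≤ hi Σ_c |logit x_c - logit x'_c|` — globally, for every `λ > 0`
(no window condition; this replaces Sly's `3/4`-step, which needs `q⁺ ≤ 3/5`). [folklore] -/
theorem hcLogit_hcStep_contract (hlam : 0 < lam) {hi : ℝ} (hhi : hi < 1) (x x' : Fin q → ℝ)
    (hx0 : ∀ c, 0 < x c) (hxh : ∀ c, x c ≤ hi) (hx0' : ∀ c, 0 < x' c) (hxh' : ∀ c, x' c ≤ hi) :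
    |hcLogit (hcStep q lam x) - hcLogit (hcStep q lam x')| ≤ hi * ∑ c, |hcLogit (x c) - hcLogit (x' c)| := by
  rw [hcLogit_hcStep hlam x fun c => by linarith [hxh c], hcLogit_hcStep hlam x' fun c => by linarith [hxh' c]]
  rw [show Real.log lam + ∑ c, Real.log (1 - x c) - (Real.log lam + ∑ c, Real.log (1 - x' c)) =
    ∑ c, (Real.log (1 - x c) - Real.log (1 - x' c)) by rw [Finset.sum_sub_distrib]; ring]
  refine (Finset.abs_sum_le_sum_abs _ _).trans ?_
  rw [Finset.mul_sum]
  exact Finset.sum_le_sum fun c _ => abs_log_one_sub_le_mul_abs_logit (hx0 c) (hxh c) (hx0' c) (hxh' c) hhi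

/-- **`L` levels contract by `ρ^L` in logit coordinates**, `ρ = max(hi, λ/(1+λ))`: for inputs in
`[lo, hi]^{q^L}` with `0 < lo`, `hi < 1` (all intermediate values are then in `(0, λ/(1+λ)]`).
[folklore] -/
theorem hcLogit_hcIter_contract (hlam : 0 < lam) {lo hi : ℝ} (hlo : 0 < lo) (hhi : hi < 1) :
    ∀ (L : ℕ) (x x' : Fin (q ^ L) → ℝ) (_ : ∀ u, x u ∈ Set.Icc lo hi) (_ : ∀ u, x' u ∈ Set.Icc lo hi),
      0 < hcIter q lam L x ∧ hcIter q lam L x ≤ max hi (lam / (1 + lam)) ∧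
      |hcLogit (hcIter q lam L x) - hcLogit (hcIter q lam L x')| ≤
        (max hi (lam / (1 + lam))) ^ L * ∑ u, |hcLogit (x u) - hcLogit (x' u)|
  | 0, x, x', hx, hx' => by
    refine ⟨hlo.trans_le (hx _).1, (hx _).2.trans (le_max_left _ _), ?_⟩
    rw [hcIter_zero, hcIter_zero, show (max hi (lam / (1 + lam))) ^ 0 = 1 from pow_zero _, one_mul]
    exact Finset.single_le_sum (f := fun u => |hcLogit (x u) - hcLogit (x' u)|) (fun u _ => abs_nonneg _)
      (Finset.mem_univ (⟨0, by simp⟩ : Fin (q ^ 0)))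
  | L + 1, x, x', hx, hx' => by
    set ρ := max hi (lam / (1 + lam)) with hρ
    have hρ1 : ρ < 1 := max_lt hhi (by rw [div_lt_one (by linarith)]; linarith)
    have IH := fun c => hcLogit_hcIter_contract hlam hlo hhi L (hcBlockConfig x c) (hcBlockConfig x' c)
      (fun u => hx _) (fun u => hx' _)
    have IH' := fun c => hcLogit_hcIter_contract hlam hlo hhi L (hcBlockConfig x' c) (hcBlockConfig x c)
      (fun u => hx' _) (fun u => hx _)
    rw [hcIter_succ, hcIter_succ]
    refine ⟨?_, ?_, ?_⟩
    · -- positivity: `Φ > 0` as `λ > 0` and all `1 - inputs > 0`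
      unfold hcStep
      have : 0 < lam * ∏ c, (1 - hcIter q lam L (hcBlockConfig x c)) :=
        mul_pos hlam (prod_pos fun c _ => by linarith [(IH c).2.1, hρ1])
      exact div_pos this (by linarith)
    · -- `Φ ≤ λ/(1+λ)`
      refine le_trans ?_ (le_max_right _ _)
      unfold hcStep
      have hP0 : 0 ≤ ∏ c, (1 - hcIter q lam L (hcBlockConfig x c)) :=
        prod_nonneg fun c _ => by linarith [(IH c).2.1, hρ1]
      have hP1 : ∏ c, (1 - hcIter q lam L (hcBlockConfig x c)) ≤ 1 := by
        calc ∏ c, (1 - hcIter q lam L (hcBlockConfig x c)) ≤ ∏ _c : Fin q, (1 : ℝ) :=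
              prod_le_prod (fun c _ => by linarith [(IH c).2.1, hρ1]) fun c _ => by linarith [(IH c).1]
          _ = 1 := by simp
      rw [div_le_div_iff₀ (by positivity) (by linarith)]
      nlinarith [mul_le_mul_of_nonneg_left hP1 hlam.le]
    · have h := hcLogit_hcStep_contract hlam hρ1 (fun c => hcIter q lam L (hcBlockConfig x c))
        (fun c => hcIter q lam L (hcBlockConfig x' c)) (fun c => (IH c).1) (fun c => (IH c).2.1)
        (fun c => (IH' c).1) (fun c => (IH' c).2.1)
      refine h.trans ?_
      calc ρ * ∑ c, |hcLogit (hcIter q lam L (hcBlockConfig x c)) - hcLogit (hcIter q lam L (hcBlockConfig x' c))|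
          ≤ ρ * ∑ c, ρ ^ L * ∑ u', |hcLogit (hcBlockConfig x c u') - hcLogit (hcBlockConfig x' c u')| :=
            mul_le_mul_of_nonneg_left (sum_le_sum fun c _ => (IH c).2.2)
              ((div_nonneg hlam.le (by linarith)).trans (le_max_right _ _))
        _ = ρ ^ (L + 1) * ∑ c, ∑ u', |hcLogit (x (hcBlock q L c u')) - hcLogit (x' (hcBlock q L c u'))| := by
            rw [← Finset.mul_sum, pow_succ]; unfold hcBlockConfig; ring
        _ = ρ ^ (L + 1) * ∑ u, |hcLogit (x u) - hcLogit (x' u)| := by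
            rw [sum_hcBlock (fun u => |hcLogit (x u) - hcLogit (x' u)|)]

end LogitContraction

section LogitConversion

/-- Elementary two-sided bounds for differences of logits: for `0 < x ≤ x' < 1`,
`(x'-x)(1/x' + 1/(1-x)) ≤ logit x' - logit x ≤ (x'-x)(1/x + 1/(1-x'))`. [folklore] -/
theorem logit_sub_logit_bounds {x x' : ℝ} (hx0 : 0 < x) (hxx' : x ≤ x') (hx1' : x' < 1) :
    (x' - x) * (1 / x' + 1 / (1 - x)) ≤ hcLogit x' - hcLogit x ∧
      hcLogit x' - hcLogit x ≤ (x' - x) * (1 / x + 1 / (1 - x')) := by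
  have hx1 : x < 1 := by linarith
  have hx0' : 0 < x' := by linarith
  rw [hcLogit_eq hx0 hx1, hcLogit_eq hx0' hx1']
  have hne : (1 - x) ≠ 0 := by linarith
  have hne' : (1 - x') ≠ 0 := by linarith
  -- the four one-sided log bounds
  have h1 : (x' - x) / x' ≤ Real.log x' - Real.log x := by
    have := Real.one_sub_inv_le_log_of_pos (div_pos hx0' hx0)
    rw [Real.log_div hx0'.ne' hx0.ne', inv_div] at this
    have e : 1 - x / x' = (x' - x) / x' := by field_simp
    linarith
  have h2 : Real.log x' - Real.log x ≤ (x' - x) / x := by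
    have := Real.log_le_sub_one_of_pos (div_pos hx0' hx0)
    rw [Real.log_div hx0'.ne' hx0.ne'] at this
    have e : x' / x - 1 = (x' - x) / x := by field_simp
    linarith
  have h3 : (x' - x) / (1 - x) ≤ Real.log (1 - x) - Real.log (1 - x') := by
    have := Real.one_sub_inv_le_log_of_pos (show 0 < (1 - x) / (1 - x') by apply div_pos <;> linarith)
    rw [Real.log_div hne hne', inv_div] at this
    have e : 1 - (1 - x') / (1 - x) = (x' - x) / (1 - x) := by field_simp; ring
    linarith
  have h4 : Real.log (1 - x) - Real.log (1 - x') ≤ (x' - x) / (1 - x') := by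
    have := Real.log_le_sub_one_of_pos (show 0 < (1 - x) / (1 - x') by apply div_pos <;> linarith)
    rw [Real.log_div hne hne'] at this
    have e : (1 - x) / (1 - x') - 1 = (x' - x) / (1 - x') := by field_simp; ring
    linarith
  constructor
  · rw [mul_add, mul_one_div, mul_one_div]; linarith
  · rw [mul_add, mul_one_div, mul_one_div]; linarith

/-- **Back from logits, I**: `|x - x'| ≤ ½ |logit x - logit x'|` on `(0,1)`. [folklore] -/
theorem abs_sub_le_half_abs_logit {x x' : ℝ} (hx0 : 0 < x) (hx1 : x < 1) (hx0' : 0 < x') (hx1' : x' < 1) :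
    |x - x'| ≤ 1 / 2 * |hcLogit x - hcLogit x'| := by
  wlog hle : x ≤ x' generalizing x x'
  · have h := this hx0' hx1' hx0 hx1 (le_of_not_ge hle)
    rwa [abs_sub_comm, abs_sub_comm (hcLogit x')] at h
  obtain ⟨h, -⟩ := logit_sub_logit_bounds hx0 hle hx1'
  have hk : 2 ≤ 1 / x' + 1 / (1 - x) := by
    have a : 1 ≤ 1 / x' := by rw [le_div_iff₀ hx0']; linarith
    have b : 1 ≤ 1 / (1 - x) := by rw [le_div_iff₀ (by linarith)]; linarith
    linarith
  have hxx : 0 ≤ x' - x := by linarith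
  have hpos : 0 ≤ hcLogit x' - hcLogit x := le_trans (mul_nonneg hxx (by linarith)) h
  rw [abs_of_nonpos (by linarith), abs_of_nonpos (by linarith)]
  nlinarith [mul_le_mul_of_nonneg_left hk hxx]

/-- **Back from logits, II**: `|logit x - logit x'| ≤ (1/lo + 1/(1-hi)) |x - x'|` on `[lo, hi] ⊂ (0,1)`.
[folklore] -/
theorem abs_logit_sub_le {x x' lo hi : ℝ} (hlo : 0 < lo) (hhi : hi < 1) (hx : x ∈ Set.Icc lo hi)
    (hx' : x' ∈ Set.Icc lo hi) : |hcLogit x - hcLogit x'| ≤ (1 / lo + 1 / (1 - hi)) * |x - x'| := by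
  wlog hle : x ≤ x' generalizing x x'
  · have h := this hx' hx (le_of_not_ge hle)
    rwa [abs_sub_comm, abs_sub_comm x'] at h
  obtain ⟨hlow, h⟩ := logit_sub_logit_bounds (hlo.trans_le hx.1) hle (hx'.2.trans_lt hhi)
  have hxx : 0 ≤ x' - x := by linarith
  have hpos : 0 ≤ hcLogit x' - hcLogit x := le_trans (mul_nonneg hxx (by
    have := hlo.trans_le hx'.1; have : 0 < 1 - x := by linarith [hx.2]
    positivity)) hlow
  rw [abs_of_nonpos (by linarith), abs_of_nonpos (by linarith), neg_sub, neg_sub]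
  have hk : 1 / x + 1 / (1 - x') ≤ 1 / lo + 1 / (1 - hi) :=
    add_le_add (one_div_le_one_div_of_le hlo hx.1) (one_div_le_one_div_of_le (by linarith) (by linarith [hx'.2]))
  calc hcLogit x' - hcLogit x ≤ (x' - x) * (1 / x + 1 / (1 - x')) := h
    _ ≤ (x' - x) * (1 / lo + 1 / (1 - hi)) := mul_le_mul_of_nonneg_left hk hxx
    _ = (1 / lo + 1 / (1 - hi)) * (x' - x) := by ring

end LogitConversion

section MarkovCut

/-- Products over the leaves block by block. [folklore] -/
theorem prod_hcBlock {q L : ℕ} {M : Type*} [CommMonoid M] (f : Fin (q ^ (L + 1)) → M) :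
    ∏ c : Fin q, ∏ i : Fin (q ^ L), f (hcBlock q L c i) = ∏ u, f u := by
  rw [← Fintype.prod_prod_type']
  exact Fintype.prod_bijective (fun p : Fin q × Fin (q ^ L) => hcBlock q L p.1 p.2)
    (hcBlockEquiv q L).bijective _ _ fun _ => rfl

/-- **The Markov property of the tree recursion (cut at level `L`)**: the partition function of the
depth-`K+L` tree is the sum over the states `s` of the `q^L` vertices on level `L` of
(top tree of depth `L` with boundary `s`) × Π_u (subtree of depth `K` below `u` with root state `s u`).
[folklore] -/
theorem hcTreeZ_cut (K : ℕ) : ∀ (L : ℕ) (r : Bool) (A : Fin (q ^ (K + L)) → Bool),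
    hcTreeZ q lam (K + L) r A =
      ∑ s : Fin (q ^ L) → Bool, hcTreeZ q lam L r s * ∏ u, hcTreeZ q lam K (s u) (hcSubConfig A u)
  | 0, r, A => by
    rw [Fintype.sum_eq_single (fun _ => r)]
    · letI : Unique (Fin (q ^ 0)) := ⟨⟨⟨0, by simp⟩⟩, fin_pow_zero_eq q⟩
      rw [hcTreeZ_zero, if_pos rfl, one_mul, Fintype.prod_unique]
      show hcTreeZ q lam K r A = hcTreeZ q lam K r (hcSubConfig A ⟨0, by simp⟩)
      congr 1
      funext j
      unfold hcSubConfig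
      congr 1
      exact Fin.ext (by simp)
    · intro s hs
      have : s ⟨0, by simp⟩ ≠ r := by
        intro h; apply hs; funext u; rw [fin_pow_zero_eq q u]; exact h
      rw [hcTreeZ_zero, if_neg this, zero_mul]
  | L + 1, r, A => by
    -- `Σ_s Z_{L+1}(r, s) Π_u … ` block by block
    have hprod : ∀ s : Fin (q ^ (L + 1)) → Bool,
        ∏ u, hcTreeZ q lam K (s u) (hcSubConfig (K := K) (L := L + 1) A u) =
          ∏ c, ∏ u', hcTreeZ q lam K (hcBlockConfig s c u')
            (hcSubConfig (K := K) (L := L) (hcBlockConfig (L := K + L) A c) u') := by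
      intro s
      rw [← prod_hcBlock (fun u => hcTreeZ q lam K (s u) (hcSubConfig (K := K) (L := L + 1) A u))]
      refine Finset.prod_congr rfl fun c _ => Finset.prod_congr rfl fun u' _ => ?_
      rw [hcSubConfig_hcBlockConfig]; rfl
    have IH : ∀ (r' : Bool) (c : Fin q), hcTreeZ q lam (K + L) r' (hcBlockConfig (L := K + L) A c) =
        ∑ s' : Fin (q ^ L) → Bool, hcTreeZ q lam L r' s' *
          ∏ u', hcTreeZ q lam K (s' u') (hcSubConfig (K := K) (L := L) (hcBlockConfig (L := K + L) A c) u') :=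
      fun r' c => hcTreeZ_cut K L r' _
    cases r with
    | true =>
      show hcTreeZ q lam (K + L + 1) true A = _
      rw [hcTreeZ_succ_true]
      simp_rw [IH, hcTreeZ_succ_true, hprod]
      rw [← sum_prod_hcBlockConfig (fun c s' => hcTreeZ q lam L false s' *
        ∏ u', hcTreeZ q lam K (s' u') (hcSubConfig (K := K) (L := L) (hcBlockConfig (L := K + L) A c) u')),
        Finset.mul_sum]
      refine Finset.sum_congr rfl fun s _ => ?_
      rw [Finset.prod_mul_distrib]; ring
    | false =>
      show hcTreeZ q lam (K + L + 1) false A = _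
      rw [hcTreeZ_succ_false]
      have htot : ∀ c, hcTreeZtot q lam (K + L) (hcBlockConfig (L := K + L) A c) =
          ∑ s' : Fin (q ^ L) → Bool, hcTreeZtot q lam L s' *
            ∏ u', hcTreeZ q lam K (s' u') (hcSubConfig (K := K) (L := L) (hcBlockConfig (L := K + L) A c) u') := by
        intro c
        unfold hcTreeZtot
        rw [IH, IH, ← Finset.sum_add_distrib]
        refine Finset.sum_congr rfl fun s' _ => ?_; ring
      simp_rw [htot, hcTreeZ_succ_false, hprod]
      rw [← sum_prod_hcBlockConfig (fun c s' => hcTreeZtot q lam L s' *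
        ∏ u', hcTreeZ q lam K (s' u') (hcSubConfig (K := K) (L := L) (hcBlockConfig (L := K + L) A c) u'))]
      refine Finset.sum_congr rfl fun s _ => ?_
      rw [Finset.prod_mul_distrib]

end MarkovCut

section SubtreeSplit

variable {w : ℝ}

/-- **The weighted Markov cut**: for any functions `f_u` of the subtree boundary configurations,
`Σ_A w^{|A|} Z_{K+L}(r, A) Π_u f_u(A|_u) = Σ_s Z_L(r, s) Π_u Σ_B w^{|B|} Z_K(s_u, B) f_u(B)` —
conditional on the states `s` of level `L`, the subtrees are independent with the root-state-`s_u`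
fugacity-`w` measures (Sly: "by the Markov property … the elements of `𝒳_{L,ℓ,s}` are conditionally
independent given `ξ_{ρ,L}`"). [cite: Sly2010, §4 (proof of Lemma 4.2)] -/
theorem hcGen_cut (K L : ℕ) (r : Bool) (f : Fin (q ^ L) → (Fin (q ^ K) → Bool) → ℝ) :
    ∑ A : Fin (q ^ (K + L)) → Bool, w ^ hcLeafCount A * hcTreeZ q lam (K + L) r A * ∏ u, f u (hcSubConfig A u) =
      ∑ s : Fin (q ^ L) → Bool, hcTreeZ q lam L r s *
        ∏ u, ∑ B : Fin (q ^ K) → Bool, w ^ hcLeafCount B * hcTreeZ q lam K (s u) B * f u B := by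
  have h1 : ∀ A : Fin (q ^ (K + L)) → Bool,
      w ^ hcLeafCount A * hcTreeZ q lam (K + L) r A * ∏ u, f u (hcSubConfig A u) =
        ∑ s : Fin (q ^ L) → Bool, hcTreeZ q lam L r s *
          ∏ u, (w ^ hcLeafCount (hcSubConfig A u) * hcTreeZ q lam K (s u) (hcSubConfig A u) * f u (hcSubConfig A u)) := by
    intro A
    rw [hcTreeZ_cut, hcLeafCount_sub, ← Finset.prod_pow_eq_pow_sum, Finset.mul_sum, Finset.sum_mul]
    refine Finset.sum_congr rfl fun s _ => ?_
    rw [Finset.prod_mul_distrib, Finset.prod_mul_distrib]; ring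
  simp_rw [h1]
  rw [Finset.sum_comm]
  refine Finset.sum_congr rfl fun s _ => ?_
  rw [← Finset.mul_sum, sum_prod_hcSubConfig (fun u B => w ^ hcLeafCount B * hcTreeZ q lam K (s u) B * f u B)]

end SubtreeSplit

section Chernoff

variable {w : ℝ}

/-- `e^t ≤ 1 + (e - 1) t` on `[0, 1]` (convexity). [folklore] -/
theorem exp_le_one_add_mul_of_mem {t : ℝ} (ht0 : 0 ≤ t) (ht1 : t ≤ 1) :
    Real.exp t ≤ 1 + (Real.exp 1 - 1) * t := by
  have h := convexOn_exp.2 (Set.mem_univ 0) (Set.mem_univ 1) (by linarith : 0 ≤ 1 - t) ht0 (by ring)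
  simp only [smul_eq_mul, mul_zero, zero_add, mul_one, Real.exp_zero] at h
  have e : (1 - t) + t * Real.exp 1 = 1 + (Real.exp 1 - 1) * t := by ring
  rw [← e]
  exact h

/-- The mean root occupation `R_K = G_K(1)/(G_K(0)+G_K(1))`. [folklore] -/
theorem hcGen_true_eq (hlam : 0 ≤ lam) (hw : 0 ≤ w) (K : ℕ) :
    hcGen q lam w K true = (hcPhi q lam)^[K] (w / (1 + w)) * (hcGen q lam w K false + hcGen q lam w K true) := by
  rw [← hcGen_ratio hlam hw K, div_mul_cancel₀ _ (hcGen_tot_pos hlam hw K).ne']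

/-- `G_K(0) = (1 - R_K)(G_K(0)+G_K(1))`. [folklore] -/
theorem hcGen_false_eq (hlam : 0 ≤ lam) (hw : 0 ≤ w) (K : ℕ) :
    hcGen q lam w K false = (1 - (hcPhi q lam)^[K] (w / (1 + w))) * (hcGen q lam w K false + hcGen q lam w K true) := by
  have := hcGen_true_eq hlam hw K (q := q)
  linarith

/-- **Exponential moment of the deviation under the root-conditioned subtree measure**: with
`D(B) = |X_K(B) - R_K| ∈ [0,1]`, `0 ≤ c ≤ 1` and `p ≤ min(R_K, 1 - R_K)`, `p > 0`,
`Σ_B w^{|B|} Z_K(r, B) e^{c D(B)} ≤ G_K(r) · (1 + (e-1) c E_ν[D] / p)` where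
`E_ν[D] = Σ_B w^{|B|} Z_K(B) D(B) / (G_K(0)+G_K(1))` (Sly: "since `P(ξ_u = 1)`, `P(ξ_u = 0)` are
bounded away from `0` … `E[|X_{u,ℓ,s} - q| ∣ ξ_{ρ,L}] ≤ C₁' exp(-C₂ℓ)`", and `E e^{|X-q|} ≤ 1 + e C₁' …`).
[cite: Sly2010, §4 (proof of Lemma 4.2, eq. (e:conditionalExpectedL1))] -/
theorem hcGen_expMoment_le (hlam : 0 ≤ lam) (hw : 0 ≤ w) (K : ℕ) (r : Bool) {c p : ℝ} (hc0 : 0 ≤ c)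
    (hc1 : c ≤ 1) (hp : 0 < p) (hpR : p ≤ (hcPhi q lam)^[K] (w / (1 + w)))
    (hpR' : p ≤ 1 - (hcPhi q lam)^[K] (w / (1 + w))) :
    ∑ B : Fin (q ^ K) → Bool, w ^ hcLeafCount B * hcTreeZ q lam K r B *
        Real.exp (c * |hcTreeX q lam K B - (hcPhi q lam)^[K] (w / (1 + w))|) ≤
      hcGen q lam w K r * (1 + (Real.exp 1 - 1) * c *
        ((∑ B : Fin (q ^ K) → Bool, w ^ hcLeafCount B * hcTreeZtot q lam K B *
          |hcTreeX q lam K B - (hcPhi q lam)^[K] (w / (1 + w))|) / (hcGen q lam w K false + hcGen q lam w K true)) / p) := by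
  set R := (hcPhi q lam)^[K] (w / (1 + w)) with hR
  set T := hcGen q lam w K false + hcGen q lam w K true with hT
  have hTpos : 0 < T := hcGen_tot_pos hlam hw K
  set ED := (∑ B : Fin (q ^ K) → Bool, w ^ hcLeafCount B * hcTreeZtot q lam K B * |hcTreeX q lam K B - R|) / T with hED
  have hD01 : ∀ B : Fin (q ^ K) → Bool, 0 ≤ |hcTreeX q lam K B - R| ∧ |hcTreeX q lam K B - R| ≤ 1 := by
    intro B
    refine ⟨abs_nonneg _, ?_⟩
    have hX := hcTreeX_mem_Icc hlam K B (q := q)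
    have hR01 : R ∈ Set.Icc (0 : ℝ) 1 := by
      rw [hR, ← hcIter_const']
      exact hcIter_mem_Icc hlam K _ fun _ => ⟨div_nonneg hw (by linarith), by rw [div_le_one (by linarith)]; linarith⟩
    rw [abs_le]; constructor <;> linarith [hX.1, hX.2, hR01.1, hR01.2]
  -- termwise: `e^{cD} ≤ 1 + (e-1) c D` and `Z_K(r,B) ≤ Z_K(B)`
  have hterm : ∀ B : Fin (q ^ K) → Bool,
      w ^ hcLeafCount B * hcTreeZ q lam K r B * Real.exp (c * |hcTreeX q lam K B - R|) ≤
        w ^ hcLeafCount B * hcTreeZ q lam K r B +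
          (Real.exp 1 - 1) * c * (w ^ hcLeafCount B * hcTreeZtot q lam K B * |hcTreeX q lam K B - R|) := by
    intro B
    have hwZ : 0 ≤ w ^ hcLeafCount B * hcTreeZ q lam K r B := mul_nonneg (pow_nonneg hw _) (hcTreeZ_nonneg hlam K r B)
    have hZle : hcTreeZ q lam K r B ≤ hcTreeZtot q lam K B := by
      unfold hcTreeZtot; cases r <;> linarith [hcTreeZ_nonneg hlam K false B (q := q), hcTreeZ_nonneg hlam K true B (q := q)]
    have he := exp_le_one_add_mul_of_mem (mul_nonneg hc0 (hD01 B).1) (by nlinarith [(hD01 B).2])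
    have he1 : 0 ≤ Real.exp 1 - 1 := by linarith [Real.add_one_le_exp 1]
    calc w ^ hcLeafCount B * hcTreeZ q lam K r B * Real.exp (c * |hcTreeX q lam K B - R|)
        ≤ w ^ hcLeafCount B * hcTreeZ q lam K r B * (1 + (Real.exp 1 - 1) * (c * |hcTreeX q lam K B - R|)) :=
          mul_le_mul_of_nonneg_left he hwZ
      _ = w ^ hcLeafCount B * hcTreeZ q lam K r B +
          (Real.exp 1 - 1) * c * (w ^ hcLeafCount B * hcTreeZ q lam K r B * |hcTreeX q lam K B - R|) := by ring
      _ ≤ _ := by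
          refine add_le_add le_rfl (mul_le_mul_of_nonneg_left ?_ (mul_nonneg he1 hc0))
          exact mul_le_mul_of_nonneg_right (mul_le_mul_of_nonneg_left hZle (pow_nonneg hw _)) (abs_nonneg _)
  have hsum := Finset.sum_le_sum fun B (_ : B ∈ univ) => hterm B
  rw [Finset.sum_add_distrib, ← Finset.mul_sum] at hsum
  -- `Σ w^|B| Z(B) D = T · ED`, and `T ≤ G_K(r)/p`
  have hS : ∑ B : Fin (q ^ K) → Bool, w ^ hcLeafCount B * hcTreeZtot q lam K B * |hcTreeX q lam K B - R| = T * ED := by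
    rw [hED, mul_div_cancel₀ _ hTpos.ne']
  have hGr : T * p ≤ hcGen q lam w K r := by
    cases r with
    | true => rw [hcGen_true_eq hlam hw K, ← hR, ← hT]; nlinarith
    | false => rw [hcGen_false_eq hlam hw K, ← hR, ← hT]; nlinarith
  have hED0 : 0 ≤ ED := div_nonneg (Finset.sum_nonneg fun B _ =>
    mul_nonneg (mul_nonneg (pow_nonneg hw _) (hcTreeZtot_pos hlam K B).le) (abs_nonneg _)) hTpos.le
  have he1 : 0 ≤ Real.exp 1 - 1 := by linarith [Real.add_one_le_exp 1]
  calc _ ≤ hcGen q lam w K r + (Real.exp 1 - 1) * c * (T * ED) := by rw [← hS]; exact hsum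
    _ ≤ hcGen q lam w K r + (Real.exp 1 - 1) * c * (hcGen q lam w K r / p * ED) := by
        refine add_le_add le_rfl (mul_le_mul_of_nonneg_left (mul_le_mul_of_nonneg_right ?_ hED0) (mul_nonneg he1 hc0))
        rw [le_div_iff₀ hp]; exact hGr
    _ = hcGen q lam w K r * (1 + (Real.exp 1 - 1) * c * ED / p) := by ring

end Chernoff

section ChernoffAssembly

variable {w : ℝ}

/-- The generating sum over the cut: `G_{K+L}(r) = Σ_s Z_L(r,s) Π_u G_K(s_u)`. [folklore] -/
theorem hcGen_add (K L : ℕ) (r : Bool) :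
    hcGen q lam w (K + L) r = ∑ s : Fin (q ^ L) → Bool, hcTreeZ q lam L r s * ∏ u, hcGen q lam w K (s u) := by
  have h := hcGen_cut (q := q) (lam := lam) (w := w) K L r (fun _ _ => 1)
  simp only [Finset.prod_const_one, mul_one] at h
  unfold hcGen
  rw [h]

/-- **The exponential moment of the total deviation factorises and is at most `(1+η)^{q^L}`**:
`Σ_A w^{|A|} Z_{K+L}(r, A) Π_u e^{c D(A|_u)} ≤ (1 + η)^{q^L} G_{K+L}(r)` with `η` as in
`hcGen_expMoment_le`. [cite: Sly2010, §4 (proof of Lemma 4.2: the display bounding `P(Σ_u |X_u - q| > (5/4)^L ∣ ξ_{ρ,L})`)] -/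
theorem hcGen_expMoment_total_le (hlam : 0 ≤ lam) (hw : 0 ≤ w) (K L : ℕ) (r : Bool) {c p : ℝ}
    (hc0 : 0 ≤ c) (hc1 : c ≤ 1) (hp : 0 < p) (hpR : p ≤ (hcPhi q lam)^[K] (w / (1 + w)))
    (hpR' : p ≤ 1 - (hcPhi q lam)^[K] (w / (1 + w))) :
    ∑ A : Fin (q ^ (K + L)) → Bool, w ^ hcLeafCount A * hcTreeZ q lam (K + L) r A *
        ∏ u, Real.exp (c * |hcTreeX q lam K (hcSubConfig A u) - (hcPhi q lam)^[K] (w / (1 + w))|) ≤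
      (1 + (Real.exp 1 - 1) * c *
        ((∑ B : Fin (q ^ K) → Bool, w ^ hcLeafCount B * hcTreeZtot q lam K B *
          |hcTreeX q lam K B - (hcPhi q lam)^[K] (w / (1 + w))|) / (hcGen q lam w K false + hcGen q lam w K true)) / p) ^ (q ^ L) *
      hcGen q lam w (K + L) r := by
  set η := (Real.exp 1 - 1) * c *
        ((∑ B : Fin (q ^ K) → Bool, w ^ hcLeafCount B * hcTreeZtot q lam K B *
          |hcTreeX q lam K B - (hcPhi q lam)^[K] (w / (1 + w))|) / (hcGen q lam w K false + hcGen q lam w K true)) / p with hη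
  have hη0 : 0 ≤ η := by
    have he1 : 0 ≤ Real.exp 1 - 1 := by linarith [Real.add_one_le_exp 1]
    refine div_nonneg (mul_nonneg (mul_nonneg he1 hc0) (div_nonneg (Finset.sum_nonneg fun B _ => ?_)
      (hcGen_tot_pos hlam hw K).le)) hp.le
    exact mul_nonneg (mul_nonneg (pow_nonneg hw _) (hcTreeZtot_pos hlam K B).le) (abs_nonneg _)
  rw [hcGen_cut K L r (fun u B => Real.exp (c * |hcTreeX q lam K B - (hcPhi q lam)^[K] (w / (1 + w))|)),
    hcGen_add K L r, Finset.mul_sum]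
  refine Finset.sum_le_sum fun s _ => ?_
  rw [mul_left_comm]
  refine mul_le_mul_of_nonneg_left ?_ (hcTreeZ_nonneg hlam L r s)
  calc ∏ u, ∑ B : Fin (q ^ K) → Bool, w ^ hcLeafCount B * hcTreeZ q lam K (s u) B *
          Real.exp (c * |hcTreeX q lam K B - (hcPhi q lam)^[K] (w / (1 + w))|)
      ≤ ∏ u, (hcGen q lam w K (s u) * (1 + η)) :=
        Finset.prod_le_prod (fun u _ => Finset.sum_nonneg fun B _ => mul_nonneg
          (mul_nonneg (pow_nonneg hw _) (hcTreeZ_nonneg hlam K _ B)) (Real.exp_pos _).le)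
          fun u _ => hcGen_expMoment_le hlam hw K (s u) hc0 hc1 hp hpR hpR'
    _ = (1 + η) ^ (q ^ L) * ∏ u, hcGen q lam w K (s u) := by
        rw [Finset.prod_mul_distrib, Finset.prod_const, Finset.card_univ, Fintype.card_fin, mul_comm]

/-- **Chernoff bound for the total deviation of the subtree marginals**: under the fugacity-`w`
boundary field of the depth-`K+L` tree, `ν{A : Σ_u |X_K(A|_u) - R_K| ≥ T} ≤ e^{-cT} (1+η)^{q^L}`.
[cite: Sly2010, §4 (proof of Lemma 4.2, Markov's inequality display)] -/
theorem hcConc_tail (hlam : 0 ≤ lam) (hw : 0 ≤ w) (K L : ℕ) {c p T : ℝ}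
    (hc0 : 0 ≤ c) (hc1 : c ≤ 1) (hp : 0 < p) (hpR : p ≤ (hcPhi q lam)^[K] (w / (1 + w)))
    (hpR' : p ≤ 1 - (hcPhi q lam)^[K] (w / (1 + w))) :
    (∑ A : Fin (q ^ (K + L)) → Bool,
        if T ≤ ∑ u, |hcTreeX q lam K (hcSubConfig A u) - (hcPhi q lam)^[K] (w / (1 + w))| then
          w ^ hcLeafCount A * hcTreeZtot q lam (K + L) A else 0) /
        (hcGen q lam w (K + L) false + hcGen q lam w (K + L) true) ≤
      Real.exp (-(c * T)) * (1 + (Real.exp 1 - 1) * c *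
        ((∑ B : Fin (q ^ K) → Bool, w ^ hcLeafCount B * hcTreeZtot q lam K B *
          |hcTreeX q lam K B - (hcPhi q lam)^[K] (w / (1 + w))|) / (hcGen q lam w K false + hcGen q lam w K true)) / p) ^ (q ^ L) := by
  set R := (hcPhi q lam)^[K] (w / (1 + w)) with hR
  set M := (1 + (Real.exp 1 - 1) * c *
        ((∑ B : Fin (q ^ K) → Bool, w ^ hcLeafCount B * hcTreeZtot q lam K B * |hcTreeX q lam K B - R|) /
          (hcGen q lam w K false + hcGen q lam w K true)) / p) ^ (q ^ L) with hM
  have hTot := hcGen_tot_pos hlam hw (K + L) (q := q)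
  rw [div_le_iff₀ hTot]
  -- indicator ≤ exp(c (S - T))
  have hind : ∀ A : Fin (q ^ (K + L)) → Bool,
      (if T ≤ ∑ u, |hcTreeX q lam K (hcSubConfig A u) - R| then w ^ hcLeafCount A * hcTreeZtot q lam (K + L) A else 0) ≤
        Real.exp (-(c * T)) * (w ^ hcLeafCount A * hcTreeZtot q lam (K + L) A *
          ∏ u, Real.exp (c * |hcTreeX q lam K (hcSubConfig A u) - R|)) := by
    intro A
    have hwZ : 0 ≤ w ^ hcLeafCount A * hcTreeZtot q lam (K + L) A :=
      mul_nonneg (pow_nonneg hw _) (hcTreeZtot_pos hlam (K + L) A).le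
    rw [Real.exp_sum _ _ |>.symm, ← Finset.mul_sum]
    split_ifs with h
    · have : 1 ≤ Real.exp (-(c * T)) * Real.exp (c * ∑ u, |hcTreeX q lam K (hcSubConfig A u) - R|) := by
        rw [← Real.exp_add]
        exact Real.one_le_exp (by nlinarith)
      calc w ^ hcLeafCount A * hcTreeZtot q lam (K + L) A
          = 1 * (w ^ hcLeafCount A * hcTreeZtot q lam (K + L) A) := (one_mul _).symm
        _ ≤ (Real.exp (-(c * T)) * Real.exp (c * ∑ u, |hcTreeX q lam K (hcSubConfig A u) - R|)) *
            (w ^ hcLeafCount A * hcTreeZtot q lam (K + L) A) := mul_le_mul_of_nonneg_right this hwZ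
        _ = _ := by ring
    · positivity
  refine (Finset.sum_le_sum fun A _ => hind A).trans ?_
  rw [← Finset.mul_sum, mul_assoc]
  refine mul_le_mul_of_nonneg_left ?_ (Real.exp_pos _).le
  -- split `Z(A) = Z(false, A) + Z(true, A)` and use the exponential moment bound twice
  have hsplit : ∑ A : Fin (q ^ (K + L)) → Bool, w ^ hcLeafCount A * hcTreeZtot q lam (K + L) A *
        ∏ u, Real.exp (c * |hcTreeX q lam K (hcSubConfig A u) - R|) =
      (∑ A : Fin (q ^ (K + L)) → Bool, w ^ hcLeafCount A * hcTreeZ q lam (K + L) false A *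
        ∏ u, Real.exp (c * |hcTreeX q lam K (hcSubConfig A u) - R|)) +
      ∑ A : Fin (q ^ (K + L)) → Bool, w ^ hcLeafCount A * hcTreeZ q lam (K + L) true A *
        ∏ u, Real.exp (c * |hcTreeX q lam K (hcSubConfig A u) - R|) := by
    rw [← Finset.sum_add_distrib]
    refine Finset.sum_congr rfl fun A _ => ?_
    unfold hcTreeZtot; ring
  rw [hsplit, mul_add]
  exact add_le_add (hcGen_expMoment_total_le hlam hw K L false hc0 hc1 hp hpR hpR')
    (hcGen_expMoment_total_le hlam hw K L true hc0 hc1 hp hpR hpR')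

end ChernoffAssembly

section MainTail

variable {w : ℝ}

/-- **The deterministic link** (contraction in logit coordinates): if the subtree marginals at
level `L` deviate in total by `< T` from their common mean `R_K`, then the root marginal of the
depth-`K+L` tree deviates from `R_{K+L} = φ^L(R_K)` by `< ½ ρ^L C T`, where the subtree marginals lie
in `[lo, hi] ⊇ [m_K, M_K]`, `ρ = max(hi, λ/(1+λ))`, `C = 1/lo + 1/(1-hi)`.
[cite: Sly2010, §4 (proof of Lemma 4.2, eq. (e:onePointCorrelations) and the last display)] -/
theorem hcTreeX_dev_lt_of_sum_lt (hlam : 0 < lam) (hw : 0 ≤ w) (K L : ℕ) {lo hi T : ℝ} (hlo : 0 < lo)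
    (hhi : hi < 1) (hmlo : lo ≤ hcm q lam K) (hMhi : hcM q lam K ≤ hi) (A : Fin (q ^ (K + L)) → Bool)
    (hT : ∑ u, |hcTreeX q lam K (hcSubConfig A u) - (hcPhi q lam)^[K] (w / (1 + w))| < T) :
    |hcTreeX q lam (K + L) A - (hcPhi q lam)^[K + L] (w / (1 + w))| <
      1 / 2 * (max hi (lam / (1 + lam))) ^ L * (1 / lo + 1 / (1 - hi)) * T := by
  set R := (hcPhi q lam)^[K] (w / (1 + w)) with hR
  set ρ := max hi (lam / (1 + lam)) with hρ
  set C := 1 / lo + 1 / (1 - hi) with hC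
  have hρ1 : ρ < 1 := max_lt hhi (by rw [div_lt_one (by linarith)]; linarith)
  -- the subtree marginals and `R` lie in `[lo, hi]`
  have henv : ∀ B : Fin (q ^ K) → Bool, hcTreeX q lam K B ∈ Set.Icc lo hi := by
    intro B
    have h := hcIter_mem_env hlam.le le_rfl zero_le_one le_rfl K (fun u => if B u then (1 : ℝ) else 0)
      fun u => by split_ifs <;> exact ⟨by norm_num, by norm_num⟩
    rw [← hcTreeX_eq_hcIter hlam.le] at h
    exact ⟨hmlo.trans h.1, h.2.trans hMhi⟩
  have hRenv : R ∈ Set.Icc lo hi := by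
    have h := hcIter_mem_env hlam.le le_rfl zero_le_one le_rfl K (fun _ : Fin (q ^ K) => w / (1 + w))
      fun _ => ⟨div_nonneg hw (by linarith), by rw [div_le_one (by linarith)]; linarith⟩
    rw [hcIter_const'] at h
    exact ⟨hmlo.trans h.1, h.2.trans hMhi⟩
  -- the two aggregations
  set x : Fin (q ^ L) → ℝ := fun u => hcTreeX q lam K (hcSubConfig A u) with hx
  have hX : hcTreeX q lam (K + L) A = hcIter q lam L x := hcTreeX_add hlam.le K L A
  have hRL : (hcPhi q lam)^[K + L] (w / (1 + w)) = hcIter q lam L fun _ => R := by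
    rw [hcIter_const', hR, ← Function.iterate_add_apply, add_comm]
  obtain ⟨hpos, hle, hcontr⟩ := hcLogit_hcIter_contract hlam hlo hhi L x (fun _ => R) (fun u => henv _) fun _ => hRenv
  obtain ⟨hpos', hle', -⟩ := hcLogit_hcIter_contract hlam hlo hhi L (fun _ => R) x (fun _ => hRenv) fun u => henv _
  rw [hX, hRL]
  have h1 := abs_sub_le_half_abs_logit hpos (hle.trans_lt hρ1) hpos' (hle'.trans_lt hρ1)
  have h2 : ∑ u, |hcLogit (x u) - hcLogit R| ≤ C * ∑ u, |x u - R| := by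
    rw [Finset.mul_sum]
    exact Finset.sum_le_sum fun u _ => abs_logit_sub_le hlo hhi (henv _) hRenv
  have hρpos : 0 < ρ := lt_max_of_lt_right (div_pos hlam (by linarith))
  have hρ0 : 0 ≤ ρ ^ L := (pow_pos hρpos L).le
  have hCpos : 0 < C := by
    rw [hC]
    have h1 : 0 < 1 / lo := one_div_pos.2 hlo
    have h2 : 0 < 1 / (1 - hi) := one_div_pos.2 (by linarith)
    linarith
  calc |hcIter q lam L x - hcIter q lam L fun _ => R|
      ≤ 1 / 2 * |hcLogit (hcIter q lam L x) - hcLogit (hcIter q lam L fun _ => R)| := h1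
    _ ≤ 1 / 2 * (ρ ^ L * ∑ u, |hcLogit (x u) - hcLogit R|) := by linarith [hcontr]
    _ ≤ 1 / 2 * (ρ ^ L * (C * ∑ u, |x u - R|)) := by
        have := mul_le_mul_of_nonneg_left h2 hρ0; linarith
    _ < 1 / 2 * ρ ^ L * C * T := by
        have hlt : ρ ^ L * (C * ∑ u, |x u - R|) < ρ ^ L * (C * T) :=
          mul_lt_mul_of_pos_left (mul_lt_mul_of_pos_left hT hCpos) (pow_pos hρpos L)
        linarith

/-- **Lemma 4.2, finite form with free parameters**: under the fugacity-`w` boundary field of the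
depth-`K+L` tree (`λ > 0`, subtree marginals in `[lo,hi]`, `0 < p ≤ min(R_K, 1-R_K)`, `0 ≤ c ≤ 1`),
`ν{A : |X_{K+L}(A) - R_{K+L}| ≥ ½ ρ^L C T} ≤ e^{-cT} (1 + (e-1) c E_ν|X_K - R_K| / p)^{q^L}`.
Sly's Lemma 4.2 is the instance `w ∈ {x₊, x₋}` (so `R_K ∈ {q⁺, q⁻}` and `E_ν|X_K - R_K| ≤ C₁e^{-C₂K}`),
`L = ⌊rℓ⌋`, `T = τ^L`. [cite: Sly2010, §4 (Lemma 4.2 and its proof)] -/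
theorem hcConc_main (hlam : 0 < lam) (hw : 0 ≤ w) (K L : ℕ) {lo hi c p T : ℝ} (hlo : 0 < lo) (hhi : hi < 1)
    (hmlo : lo ≤ hcm q lam K) (hMhi : hcM q lam K ≤ hi) (hc0 : 0 ≤ c) (hc1 : c ≤ 1) (hp : 0 < p)
    (hpR : p ≤ (hcPhi q lam)^[K] (w / (1 + w))) (hpR' : p ≤ 1 - (hcPhi q lam)^[K] (w / (1 + w))) :
    (∑ A : Fin (q ^ (K + L)) → Bool,
        if 1 / 2 * (max hi (lam / (1 + lam))) ^ L * (1 / lo + 1 / (1 - hi)) * T ≤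
            |hcTreeX q lam (K + L) A - (hcPhi q lam)^[K + L] (w / (1 + w))| then
          w ^ hcLeafCount A * hcTreeZtot q lam (K + L) A else 0) /
        (hcGen q lam w (K + L) false + hcGen q lam w (K + L) true) ≤
      Real.exp (-(c * T)) * (1 + (Real.exp 1 - 1) * c *
        ((∑ B : Fin (q ^ K) → Bool, w ^ hcLeafCount B * hcTreeZtot q lam K B *
          |hcTreeX q lam K B - (hcPhi q lam)^[K] (w / (1 + w))|) / (hcGen q lam w K false + hcGen q lam w K true)) / p) ^ (q ^ L) := by
  refine le_trans ?_ (hcConc_tail hlam.le hw K L hc0 hc1 hp hpR hpR')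
  refine div_le_div_of_nonneg_right (Finset.sum_le_sum fun A _ => ?_) (hcGen_tot_pos hlam.le hw (K + L)).le
  have hwZ : 0 ≤ w ^ hcLeafCount A * hcTreeZtot q lam (K + L) A :=
    mul_nonneg (pow_nonneg hw _) (hcTreeZtot_pos hlam.le (K + L) A).le
  split_ifs with h1 h2 h2
  · exact le_rfl
  · exact absurd h1 (not_le.2 (hcTreeX_dev_lt_of_sum_lt hlam hw K L hlo hhi hmlo hMhi A (not_le.1 h2)))
  · exact hwZ
  · exact le_rfl

end MainTail

/-! ### Part III: rates — deviations from below, cycle fugacities -/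

section RatesPrep

variable {w : ℝ}

/-- Mean absolute deviation from below: a random variable bounded below by `m` with mean `μ` has
`E|Y - μ| ≤ 2(μ - m)`. [folklore] -/
theorem sum_abs_sub_mean_le' {ι : Type*} (s : Finset ι) (p y : ι → ℝ) (hp : ∀ i ∈ s, 0 ≤ p i)
    (hsum : ∑ i ∈ s, p i = 1) {m : ℝ} (hy : ∀ i ∈ s, m ≤ y i) :
    ∑ i ∈ s, p i * |y i - ∑ j ∈ s, p j * y j| ≤ 2 * (∑ j ∈ s, p j * y j - m) := by
  have h := sum_abs_sub_mean_le s p (fun i => -y i) hp hsum (M := -m) fun i hi => neg_le_neg (hy i hi)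
  have e1 : ∑ j ∈ s, p j * -y j = -∑ j ∈ s, p j * y j := by
    rw [← Finset.sum_neg_distrib]; exact Finset.sum_congr rfl fun j _ => by ring
  rw [e1] at h
  refine le_trans (le_of_eq (Finset.sum_congr rfl fun i _ => ?_)) (h.trans (le_of_eq (by ring)))
  rw [show -y i - -∑ j ∈ s, p j * y j = -(y i - ∑ j ∈ s, p j * y j) by ring, abs_neg]

/-- **Deviation bound from the lower envelope**: `E_ν|X_L - R_L| ≤ 2(R_L - m_L)` (used at the heights
where the mean is `q⁻`). [cite: Sly2010, §4 (eq. (e:treeReconDecay2))] -/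
theorem hcTreeX_meanAbsDev_le' (hlam : 0 ≤ lam) (hw : 0 ≤ w) (L : ℕ) :
    (∑ A : Fin (q ^ L) → Bool, w ^ hcLeafCount A * hcTreeZtot q lam L A *
        |hcTreeX q lam L A - (hcPhi q lam)^[L] (w / (1 + w))|) /
        (hcGen q lam w L false + hcGen q lam w L true) ≤
      2 * ((hcPhi q lam)^[L] (w / (1 + w)) - hcm q lam L) := by
  have hT := hcGen_tot_pos hlam hw L (q := q)
  set T := hcGen q lam w L false + hcGen q lam w L true with hTdef
  set p : (Fin (q ^ L) → Bool) → ℝ := fun A => w ^ hcLeafCount A * hcTreeZtot q lam L A / T with hpdef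
  have hp0 : ∀ A, 0 ≤ p A := fun A => div_nonneg (mul_nonneg (pow_nonneg hw _) (hcTreeZtot_pos hlam L A).le) hT.le
  have hpsum : ∑ A, p A = 1 := by
    simp only [hpdef, ← Finset.sum_div]
    rw [div_eq_one_iff_eq hT.ne', hTdef]
    unfold hcGen
    rw [← Finset.sum_add_distrib]
    refine Finset.sum_congr rfl fun A _ => ?_
    unfold hcTreeZtot; ring
  have hmean : ∑ A, p A * hcTreeX q lam L A = (hcPhi q lam)^[L] (w / (1 + w)) := by
    rw [← hcGen_ratio hlam hw L, hTdef.symm] at *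
    simp only [hpdef]
    rw [show (∑ A, w ^ hcLeafCount A * hcTreeZtot q lam L A / T * hcTreeX q lam L A) =
      (∑ A, w ^ hcLeafCount A * hcTreeZ q lam L true A) / T from ?_]
    · rfl
    rw [Finset.sum_div]
    refine Finset.sum_congr rfl fun A _ => ?_
    have hZ := hcTreeZtot_pos hlam L A (q := q)
    unfold hcTreeX
    field_simp
  have hbound : ∀ A, hcm q lam L ≤ hcTreeX q lam L A := by
    intro A
    have h := hcIter_mem_env hlam le_rfl zero_le_one le_rfl L (fun u => if A u then (1 : ℝ) else 0)
      fun u => by split_ifs <;> exact ⟨by norm_num, by norm_num⟩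
    rw [← hcTreeX_eq_hcIter hlam] at h
    exact h.1
  have key := sum_abs_sub_mean_le' univ p (fun A => hcTreeX q lam L A) (fun A _ => hp0 A) hpsum fun A _ => hbound A
  rw [hmean] at key
  refine le_trans (le_of_eq ?_) key
  rw [Finset.sum_div]
  refine Finset.sum_congr rfl fun A _ => ?_
  simp only [hpdef]
  ring

/-- **The cycle fugacity**: if `w/(1+w) = y` and `(y, φ y)` is a two-cycle then the mean root marginal
alternates, `R_K = φ^K(y) ∈ {y, φ y}` by parity. [folklore] -/
theorem iterate_two_cycle {f : ℝ → ℝ} {y : ℝ} (hcyc : f (f y) = y) (K : ℕ) :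
    f^[2 * K] y = y ∧ f^[2 * K + 1] y = f y := by
  induction K with
  | zero => simp
  | succ K ih =>
    obtain ⟨h1, h2⟩ := ih
    constructor
    · rw [show 2 * (K + 1) = (2 * K + 1) + 1 by ring, Function.iterate_succ_apply', h2, hcyc]
    · rw [show 2 * (K + 1) + 1 = (2 * (K + 1)) + 1 by ring, Function.iterate_succ_apply',
        show 2 * (K + 1) = (2 * K + 1) + 1 by ring, Function.iterate_succ_apply', h2, hcyc]

end RatesPrep

section PhiLipschitz

/-- A sum of `q` mixed powers of two numbers in `[0, M]` is at most `q M^{q-1}`. [folklore] -/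
theorem geom_sum₂_le {a b M : ℝ} (ha0 : 0 ≤ a) (haM : a ≤ M) (hb0 : 0 ≤ b) (hbM : b ≤ M) (q : ℕ) :
    ∑ i ∈ range q, a ^ i * b ^ (q - 1 - i) ≤ q * M ^ (q - 1) := by
  have hM : 0 ≤ M := ha0.trans haM
  calc ∑ i ∈ range q, a ^ i * b ^ (q - 1 - i) ≤ ∑ _i ∈ range q, M ^ (q - 1) := by
        refine Finset.sum_le_sum fun i hi => ?_
        rw [Finset.mem_range] at hi
        calc a ^ i * b ^ (q - 1 - i) ≤ M ^ i * M ^ (q - 1 - i) :=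
              mul_le_mul (pow_le_pow_left₀ ha0 haM i) (pow_le_pow_left₀ hb0 hbM _) (pow_nonneg hb0 _) (pow_nonneg hM _)
          _ = M ^ (q - 1) := by rw [← pow_add]; congr 1; omega
    _ = q * M ^ (q - 1) := by rw [Finset.sum_const, Finset.card_range, nsmul_eq_mul]

/-- **Explicit Lipschitz bound for `φ` on a window**: for `y, y' ∈ [a, b]`, `b ≤ 1`, and `λ ≥ 0`,
`|φ(y) - φ(y')| ≤ Λ(a,b) |y - y'|` with `Λ(a,b) = λ q (1-a)^{q-1} / (1 + λ(1-b)^q)²`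
(as the window shrinks to `y₀`, `Λ → |φ'(y₀)| = q φ(y₀)(1-φ(y₀))/(1-y₀)`). [folklore] -/
theorem hcPhi_lipschitz_on (hlam : 0 ≤ lam) {a b y y' : ℝ} (hb1 : b ≤ 1)
    (hy : y ∈ Set.Icc a b) (hy' : y' ∈ Set.Icc a b) :
    |hcPhi q lam y - hcPhi q lam y'| ≤ lam * q * (1 - a) ^ (q - 1) / (1 + lam * (1 - b) ^ q) ^ 2 * |y - y'| := by
  wlog hle : y ≤ y' generalizing y y'
  · have h := this hy' hy (le_of_not_ge hle)
    rwa [abs_sub_comm, abs_sub_comm y'] at h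
  set A : ℝ := lam * (1 - y) ^ q with hA
  set A' : ℝ := lam * (1 - y') ^ q with hA'
  have h1y : 0 ≤ 1 - y := by linarith [hy.2]
  have h1y' : 0 ≤ 1 - y' := by linarith [hy'.2]
  have hA0 : 0 ≤ A' := mul_nonneg hlam (pow_nonneg h1y' _)
  have hAA : A' ≤ A := mul_le_mul_of_nonneg_left (pow_le_pow_left₀ h1y' (by linarith) _) hlam
  have hB : lam * (1 - b) ^ q ≤ A' := mul_le_mul_of_nonneg_left (pow_le_pow_left₀ (by linarith) (by linarith [hy'.2]) _) hlam
  have hB0 : 0 ≤ lam * (1 - b) ^ q := mul_nonneg hlam (pow_nonneg (by linarith) _)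
  -- `φ(y) - φ(y') = (A - A')/((1+A)(1+A'))`
  have e : hcPhi q lam y - hcPhi q lam y' = (A - A') / ((1 + A) * (1 + A')) := by
    rw [hcPhi_eq, hcPhi_eq, ← hA, ← hA']
    have : (1 + A) ≠ 0 := by linarith
    have : (1 + A') ≠ 0 := by linarith
    field_simp
    ring
  -- `A - A' = λ S (y' - y)` with `S ≤ q (1-a)^{q-1}`
  have hS := geom_sum₂_le h1y (by linarith [hy.1] : 1 - y ≤ 1 - a) h1y' (by linarith [hy'.1] : 1 - y' ≤ 1 - a) q
  have hgeom : (∑ i ∈ range q, (1 - y) ^ i * (1 - y') ^ (q - 1 - i)) * ((1 - y) - (1 - y')) = (1 - y) ^ q - (1 - y') ^ q :=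
    (Commute.all _ _).geom_sum₂_mul q
  have hdiff : A - A' = lam * (∑ i ∈ range q, (1 - y) ^ i * (1 - y') ^ (q - 1 - i)) * (y' - y) := by
    rw [hA, hA', ← mul_sub, ← hgeom]; ring
  have hS0 : 0 ≤ ∑ i ∈ range q, (1 - y) ^ i * (1 - y') ^ (q - 1 - i) :=
    Finset.sum_nonneg fun i _ => mul_nonneg (pow_nonneg h1y _) (pow_nonneg h1y' _)
  have hyy : 0 ≤ y' - y := by linarith
  have hnum : 0 ≤ A - A' := by rw [hdiff]; exact mul_nonneg (mul_nonneg hlam hS0) hyy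
  have hden : (1 + lam * (1 - b) ^ q) ^ 2 ≤ (1 + A) * (1 + A') := by
    rw [sq]; exact mul_le_mul (by linarith) (by linarith) (by linarith) (by linarith)
  have hden0 : 0 < (1 + lam * (1 - b) ^ q) ^ 2 := by positivity
  rw [e, abs_div, abs_of_nonneg hnum, abs_of_pos (by positivity : 0 < (1 + A) * (1 + A')),
    abs_of_nonpos (by linarith), neg_sub]
  calc (A - A') / ((1 + A) * (1 + A')) ≤ (A - A') / (1 + lam * (1 - b) ^ q) ^ 2 :=
        div_le_div_of_nonneg_left hnum hden0 hden
    _ ≤ lam * (q * (1 - a) ^ (q - 1)) * (y' - y) / (1 + lam * (1 - b) ^ q) ^ 2 := by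
        rw [hdiff]
        refine div_le_div_of_nonneg_right ?_ hden0.le
        exact mul_le_mul_of_nonneg_right (mul_le_mul_of_nonneg_left hS hlam) hyy
    _ = lam * q * (1 - a) ^ (q - 1) / (1 + lam * (1 - b) ^ q) ^ 2 * (y' - y) := by ring

/-- The global Lipschitz constant `λ q` of `φ` on `[0,1]`. [folklore] -/
theorem hcPhi_lipschitz (hlam : 0 ≤ lam) {y y' : ℝ} (hy : y ∈ Set.Icc (0 : ℝ) 1) (hy' : y' ∈ Set.Icc (0 : ℝ) 1) :
    |hcPhi q lam y - hcPhi q lam y'| ≤ lam * q * |y - y'| := by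
  have h := hcPhi_lipschitz_on (q := q) hlam le_rfl hy hy'
  refine h.trans (mul_le_mul_of_nonneg_right ?_ (abs_nonneg _))
  rw [sub_zero, one_pow, mul_one, sub_self]
  rcases Nat.eq_zero_or_pos q with hq | hq
  · subst hq; simp
  · rw [zero_pow hq.ne', mul_zero, add_zero, one_pow, div_one]

end PhiLipschitz

section Decay

open Filter Topology

/-- **Abstract geometric decay**: a nonnegative bounded sequence that is eventually small and
eventually contracts decays geometrically from the start (with a worse constant). [folklore] -/
theorem geometric_decay {e : ℕ → ℝ} {κ δ B : ℝ} {j₀ : ℕ} (he0 : ∀ j, 0 ≤ e j) (heB : ∀ j, e j ≤ B)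
    (hκ0 : 0 < κ) (hκ1 : κ ≤ 1) (hsmall : ∀ j, j₀ ≤ j → e j ≤ δ)
    (hstep : ∀ j, j₀ ≤ j → e (j + 1) ≤ κ * e j) :
    ∀ j, e j ≤ max δ B / κ ^ j₀ * κ ^ j := by
  have hpow : ∀ i, e (j₀ + i) ≤ κ ^ i * e j₀ := by
    intro i
    induction i with
    | zero => simp
    | succ i ih =>
      calc e (j₀ + (i + 1)) = e (j₀ + i + 1) := by rw [add_assoc]
        _ ≤ κ * e (j₀ + i) := hstep _ (by omega)
        _ ≤ κ * (κ ^ i * e j₀) := mul_le_mul_of_nonneg_left ih hκ0.le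
        _ = κ ^ (i + 1) * e j₀ := by rw [pow_succ]; ring
  have hκj₀ : 0 < κ ^ j₀ := pow_pos hκ0 j₀
  intro j
  rcases le_or_gt j₀ j with hj | hj
  · obtain ⟨i, rfl⟩ := Nat.exists_eq_add_of_le hj
    calc e (j₀ + i) ≤ κ ^ i * e j₀ := hpow i
      _ ≤ κ ^ i * δ := mul_le_mul_of_nonneg_left (hsmall _ le_rfl) (pow_nonneg hκ0.le i)
      _ ≤ κ ^ i * max δ B := mul_le_mul_of_nonneg_left (le_max_left _ _) (pow_nonneg hκ0.le i)
      _ = max δ B / κ ^ j₀ * κ ^ (j₀ + i) := by rw [pow_add]; field_simp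
  · have hB : 0 ≤ B := (he0 0).trans (heB 0)
    have h1 : κ ^ j₀ ≤ κ ^ j := pow_le_pow_of_le_one hκ0.le hκ1 hj.le
    calc e j ≤ B := heB j
      _ ≤ max δ B := le_max_right _ _
      _ = max δ B / κ ^ j₀ * κ ^ j₀ := by field_simp
      _ ≤ max δ B / κ ^ j₀ * κ ^ j :=
          mul_le_mul_of_nonneg_left h1 (div_nonneg (hB.trans (le_max_right _ _)) hκj₀.le)

/-- **The extreme-boundary marginals converge geometrically**: for `d ≥ 3`, `λ > 0` and the two-cycle
`0 < q⁻ < q⁺ < 1` of `φ` (`q = d - 1`), there are `C ≥ 0` and `κ ∈ (0,1)` with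
`M_{2j} - q⁺ ≤ C κ^j` and `q⁻ - m_{2j} ≤ C κ^j` for all `j` — the two-cycle is STRICTLY attracting
(`twoCycle_multiplier_lt_one`), so `ψ = φ ∘ φ` contracts near `q^{±}` (window Lipschitz constants
`hcΛ`, `hcPhi_lipschitz_on`) once the envelopes have entered the window (`hcEnv_eventually`).
This gives the exponential rate in Sly's (e:treeReconDecay2) via `hcTreeX_meanAbsDev_le(')`.
[cite: Sly2010, §4 (eq. (e:treeReconDecay2): "`E|X̃_{v,ℓ,s} - p| ≤ C̃₁ exp(-C̃₂ ℓ)`")] -/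
theorem hcEnv_geometric {d : ℕ} (hd : 3 ≤ d) {lam : ℝ} (hlam : 0 < lam) {qp qm : ℝ} (hqm : 0 < qm)
    (hlt : qm < qp) (hqp1 : qp < 1) (hp : qp = hcPhi (d - 1) lam qm) (hm : qm = hcPhi (d - 1) lam qp) :
    ∃ C κ : ℝ, 0 ≤ C ∧ 0 < κ ∧ κ < 1 ∧ ∀ j : ℕ,
      hcM (d - 1) lam (2 * j) - qp ≤ C * κ ^ j ∧ qm - hcm (d - 1) lam (2 * j) ≤ C * κ ^ j := by
  set q := d - 1 with hq
  have hq1 : 1 ≤ q := by omega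
  have hqm1 : qm < 1 := hlt.trans hqp1
  set φ := hcPhi q lam with hφ
  set Λ := hcΛ q lam with hΛ
  -- the two contraction factors as functions of the window size `δ`
  set κ₁ : ℝ → ℝ := fun δ => Λ qp (qp + δ) * Λ (qm - Λ qp (qp + δ) * δ) qm with hκ₁
  set κ₂ : ℝ → ℝ := fun δ => Λ (qm - δ) qm * Λ qp (qp + Λ (qm - δ) qm * δ) with hκ₂
  -- their common value at `0` is the multiplier `q² q⁺ q⁻ < 1`
  have hμ : Λ qp qp * Λ qm qm = (q : ℝ) ^ 2 * (qp * qm) := by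
    rw [hΛ, hcΛ_diag hq1 hqp1, hcΛ_diag hq1 hqm1, show hcPhi q lam qm = qp from hp.symm,
      show hcPhi q lam qp = qm from hm.symm]
    have : (1 - qp) ≠ 0 := by linarith
    have : (1 - qm) ≠ 0 := by linarith
    field_simp
  have hμ1 : (q : ℝ) ^ 2 * (qp * qm) < 1 := by
    have := twoCycle_multiplier_lt_one hd hlam hlt hqp1 hp hm
    rwa [show ((d : ℝ) - 1) = (q : ℝ) by rw [hq, Nat.cast_sub (by omega)]; simp] at this
  have hκ₁0 : κ₁ 0 = Λ qp qp * Λ qm qm := by simp [hκ₁]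
  have hκ₂0 : κ₂ 0 = Λ qp qp * Λ qm qm := by simp [hκ₂, mul_comm]
  -- continuity at `0`
  have hden : ∀ b : ℝ, b < 1 → (1 + lam * (1 - b) ^ q) ^ 2 ≠ 0 := fun b hb => by
    have : 0 < 1 + lam * (1 - b) ^ q := by have := mul_nonneg hlam.le (pow_nonneg (by linarith : (0:ℝ) ≤ 1 - b) q); linarith
    positivity
  have hΛcont : ∀ (f g : ℝ → ℝ), ContinuousAt f 0 → ContinuousAt g 0 → g 0 < 1 →
      ContinuousAt (fun δ => Λ (f δ) (g δ)) 0 := by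
    intro f g hf hg hg1
    simp only [hΛ, hcΛ_def]
    refine ContinuousAt.div ?_ ?_ (hden _ hg1)
    · exact (continuousAt_const.mul ((continuousAt_const.sub hf).pow _))
    · exact (continuousAt_const.add (continuousAt_const.mul ((continuousAt_const.sub hg).pow _))).pow _
  have hc1 : ContinuousAt κ₁ 0 := by
    have hA : ContinuousAt (fun δ : ℝ => Λ qp (qp + δ)) 0 :=
      hΛcont _ _ continuousAt_const (continuousAt_const.add continuousAt_id) (by norm_num [hqp1])
    have hB : ContinuousAt (fun δ : ℝ => Λ (qm - Λ qp (qp + δ) * δ) qm) 0 :=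
      hΛcont _ _ (continuousAt_const.sub (hA.mul continuousAt_id)) continuousAt_const (by norm_num [hqm1])
    exact hA.mul hB
  have hc2 : ContinuousAt κ₂ 0 := by
    have hA : ContinuousAt (fun δ : ℝ => Λ (qm - δ) qm) 0 :=
      hΛcont _ _ (continuousAt_const.sub continuousAt_id) continuousAt_const (by norm_num [hqm1])
    have hB : ContinuousAt (fun δ : ℝ => Λ qp (qp + Λ (qm - δ) qm * δ)) 0 :=
      hΛcont _ _ continuousAt_const (continuousAt_const.add (hA.mul continuousAt_id)) (by norm_num [hqp1])
    exact hA.mul hB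
  -- pick `δ > 0` with both factors `≤ κ := (1 + μ)/2 < 1` and the windows inside `[·, 1]`
  set μ := (q : ℝ) ^ 2 * (qp * qm) with hμdef
  set κ := (1 + μ) / 2 with hκdef
  have hμκ : μ < κ := by rw [hκdef]; linarith
  have hκlt1 : κ < 1 := by rw [hκdef]; linarith
  have hμ0 : 0 < μ := by
    rw [hμdef]; have : (1:ℝ) ≤ q := by exact_mod_cast hq1
    have := hqm.trans hlt; positivity
  have hκ0 : 0 < κ := by rw [hκdef]; linarith
  have ev1 : ∀ᶠ δ in 𝓝 (0 : ℝ), κ₁ δ < κ := hc1.eventually (gt_mem_nhds (by rw [hκ₁0, hμ]; exact hμκ))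
  have ev2 : ∀ᶠ δ in 𝓝 (0 : ℝ), κ₂ δ < κ := hc2.eventually (gt_mem_nhds (by rw [hκ₂0, hμ]; exact hμκ))
  have ev3 : ∀ᶠ δ in 𝓝 (0 : ℝ), qp + δ < 1 :=
    (continuousAt_const.add continuousAt_id).eventually (gt_mem_nhds (by norm_num [hqp1]))
  have ev4 : ∀ᶠ δ in 𝓝 (0 : ℝ), qp + Λ (qm - δ) qm * δ < 1 := by
    have hA : ContinuousAt (fun δ : ℝ => Λ (qm - δ) qm) 0 :=
      hΛcont _ _ (continuousAt_const.sub continuousAt_id) continuousAt_const (by norm_num [hqm1])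
    exact (continuousAt_const.add (hA.mul continuousAt_id)).eventually (gt_mem_nhds (by norm_num [hqp1]))
  obtain ⟨ε, hε, hball⟩ := Metric.eventually_nhds_iff.1 (ev1.and (ev2.and (ev3.and ev4)))
  set δ := ε / 2 with hδ
  have hδ0 : 0 < δ := by positivity
  obtain ⟨h1, h2, h3, h4⟩ := hball (y := δ) (by rw [Real.dist_eq, sub_zero, abs_of_pos hδ0, hδ]; linarith)
  -- Lipschitz constants are nonnegative
  have hΛnn : ∀ a b : ℝ, b ≤ 1 → a ≤ 1 → 0 ≤ Λ a b := fun a b hb ha => by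
    simp only [hΛ, hcΛ_def]
    exact div_nonneg (mul_nonneg (mul_nonneg hlam.le (Nat.cast_nonneg _)) (pow_nonneg (by linarith) _)) (sq_nonneg _)
  -- envelopes eventually in the window
  obtain ⟨k₀, hk₀⟩ := hcEnv_eventually hd hlam hqm hlt hqp1 hp hm hδ0
  have henc := hcEnv_encloses (q := q) hlam.le hqm.le hqp1.le hp hm
  have hmem := hcm_le_hcM_mem (q := q) hlam.le
  -- the two error sequences
  set e : ℕ → ℝ := fun j => hcM q lam (2 * j) - qp with he
  set f : ℕ → ℝ := fun j => qm - hcm q lam (2 * j) with hf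
  have he0 : ∀ j, 0 ≤ e j := fun j => by simp only [he]; linarith [(henc (2 * j)).2]
  have hf0 : ∀ j, 0 ≤ f j := fun j => by simp only [hf]; linarith [(henc (2 * j)).1]
  have heB : ∀ j, e j ≤ 1 := fun j => by simp only [he]; linarith [(hmem (2 * j)).2.2, hqm.trans hlt]
  have hfB : ∀ j, f j ≤ 1 := fun j => by simp only [hf]; linarith [(hmem (2 * j)).1]
  have hesmall : ∀ j, k₀ ≤ j → e j ≤ δ := fun j hj => by simp only [he]; linarith [(hk₀ (2 * j) (by omega)).1]
  have hfsmall : ∀ j, k₀ ≤ j → f j ≤ δ := fun j hj => by simp only [hf]; linarith [(hk₀ (2 * j) (by omega)).2]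
  -- the contraction steps
  have hψ : ∀ j, hcM q lam (2 * (j + 1)) = φ (φ (hcM q lam (2 * j))) ∧ hcm q lam (2 * (j + 1)) = φ (φ (hcm q lam (2 * j))) := by
    intro j
    simp only [show 2 * (j + 1) = 2 * j + 1 + 1 by ring, hcM_succ, hcm_succ]
    exact ⟨rfl, rfl⟩
  have hestep : ∀ j, k₀ ≤ j → e (j + 1) ≤ κ * e j := by
    intro j hj
    have hMj := (hk₀ (2 * j) (by omega)).1
    have hMge : qp ≤ hcM q lam (2 * j) := (henc _).2
    set M := hcM q lam (2 * j) with hMdef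
    -- first step: `|φ M - φ qp| ≤ Λ₁ (M - qp)`, `φ M ≤ qm`
    have hL1 := hcPhi_lipschitz_on (q := q) hlam.le (a := qp) (b := qp + δ) (by linarith) ⟨hMge, hMj⟩ ⟨le_rfl, by linarith⟩
    rw [← hφ, ← hcΛ_def, ← hΛ] at hL1
    have hφM : φ M ≤ qm := by rw [hm]; exact hcPhi_antitone hlam.le hMge (by linarith)
    have hgap : qm - φ M ≤ Λ qp (qp + δ) * δ := by
      have : |φ M - φ qp| = qm - φ M := by rw [← hm, abs_sub_comm, abs_of_nonneg (by linarith)]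
      rw [this, abs_of_nonneg (by linarith : 0 ≤ M - qp)] at hL1
      exact hL1.trans (mul_le_mul_of_nonneg_left (by linarith) (hΛnn _ _ (by linarith) hqp1.le))
    -- second step on the window `[qm - Λ₁ δ, qm]`
    have hL2 := hcPhi_lipschitz_on (q := q) hlam.le (a := qm - Λ qp (qp + δ) * δ) (b := qm) hqm1.le
      (y := φ M) (y' := qm) ⟨by linarith, hφM⟩ ⟨by linarith [mul_nonneg (hΛnn qp (qp + δ) (by linarith) hqp1.le) hδ0.le], le_rfl⟩
    rw [← hφ, ← hcΛ_def, ← hΛ] at hL2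
    have : e (j + 1) = φ (φ M) - φ qm := by simp only [he, (hψ j).1, ← hMdef, ← hp]
    rw [this]
    have hL1' : |φ M - qm| ≤ Λ qp (qp + δ) * (M - qp) := by
      rw [hm]; rw [abs_of_nonneg (by linarith : 0 ≤ M - qp)] at hL1; exact hL1
    calc φ (φ M) - φ qm ≤ |φ (φ M) - φ qm| := le_abs_self _
      _ ≤ Λ (qm - Λ qp (qp + δ) * δ) qm * |φ M - qm| := hL2
      _ ≤ Λ (qm - Λ qp (qp + δ) * δ) qm * (Λ qp (qp + δ) * (M - qp)) :=
          mul_le_mul_of_nonneg_left hL1' (hΛnn _ _ hqm1.le (by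
            linarith [mul_nonneg (hΛnn qp (qp + δ) (by linarith) hqp1.le) hδ0.le]))
      _ = κ₁ δ * e j := by simp only [hκ₁, he, ← hMdef]; ring
      _ ≤ κ * e j := mul_le_mul_of_nonneg_right h1.le (he0 j)
  have hfstep : ∀ j, k₀ ≤ j → f (j + 1) ≤ κ * f j := by
    intro j hj
    have hmj := (hk₀ (2 * j) (by omega)).2
    have hmle : hcm q lam (2 * j) ≤ qm := (henc _).1
    set mm := hcm q lam (2 * j) with hmdef
    have hm0 : 0 ≤ mm := (hmem _).1
    -- first step on `[qm - δ, qm]`: `φ mm - qp ≤ Λ' (qm - mm)`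
    have hL1 := hcPhi_lipschitz_on (q := q) hlam.le (a := qm - δ) (b := qm) hqm1.le (y := mm) (y' := qm) ⟨hmj, hmle⟩ ⟨by linarith, le_rfl⟩
    rw [← hφ, ← hcΛ_def, ← hΛ] at hL1
    have hφm : qp ≤ φ mm := by rw [hp]; exact hcPhi_antitone hlam.le hmle hqm1.le
    have hL1' : φ mm - qp ≤ Λ (qm - δ) qm * (qm - mm) := by
      rw [hp]; rw [abs_sub_comm mm, abs_of_nonneg (by linarith : 0 ≤ qm - mm), abs_of_nonneg (by rw [← hp]; linarith)] at hL1
      linarith [hL1]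
    have hgap : φ mm - qp ≤ Λ (qm - δ) qm * δ :=
      hL1'.trans (mul_le_mul_of_nonneg_left (by linarith) (hΛnn _ _ hqm1.le (by linarith)))
    -- second step on `[qp, qp + Λ' δ]`
    have hL2 := hcPhi_lipschitz_on (q := q) hlam.le (a := qp) (b := qp + Λ (qm - δ) qm * δ) h4.le
      (y := qp) (y' := φ mm) ⟨le_rfl, by linarith [mul_nonneg (hΛnn (qm - δ) qm hqm1.le (by linarith)) hδ0.le]⟩ ⟨hφm, by linarith⟩
    rw [← hφ, ← hcΛ_def, ← hΛ] at hL2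
    have : f (j + 1) = φ qp - φ (φ mm) := by simp only [hf, (hψ j).2, ← hmdef, ← hm]
    rw [this]
    calc φ qp - φ (φ mm) ≤ |φ qp - φ (φ mm)| := le_abs_self _
      _ ≤ Λ qp (qp + Λ (qm - δ) qm * δ) * |qp - φ mm| := hL2
      _ = Λ qp (qp + Λ (qm - δ) qm * δ) * (φ mm - qp) := by rw [abs_sub_comm, abs_of_nonneg (by linarith)]
      _ ≤ Λ qp (qp + Λ (qm - δ) qm * δ) * (Λ (qm - δ) qm * (qm - mm)) :=
          mul_le_mul_of_nonneg_left hL1' (hΛnn _ _ h4.le hqp1.le)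
      _ = κ₂ δ * f j := by simp only [hκ₂, hf, ← hmdef]; ring
      _ ≤ κ * f j := mul_le_mul_of_nonneg_right h2.le (hf0 j)
  -- conclude
  have hE := geometric_decay he0 heB hκ0 hκlt1.le hesmall hestep
  have hF := geometric_decay hf0 hfB hκ0 hκlt1.le hfsmall hfstep
  refine ⟨max δ 1 / κ ^ k₀, κ, by positivity, hκ0, hκlt1, fun j => ⟨hE j, hF j⟩⟩

end Decay

section Asymptotics

open Filter Topology

/-- **The parameter bookkeeping of Lemma 4.2**: given the per-level contraction `ρ < 1`, the decay
rate `κ₀ < 1` of `E|X_K - R_K|`, the branching `q`, and constants `A ≥ 0`, `B ≥ 0`, there are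
`r ∈ (0, 1)` (Sly's `L = ⌊rℓ⌋`), `τ ∈ (1, 1/ρ)` (his `5/4`) and rates `ζ₁, ζ₂ > 0` such that for all
large `ℓ`, with `L = ⌊rℓ⌋`, `K = ℓ - L`: `K ≥ 3`, `A q^L κ₀^K ≤ 1`, `e^{1-τ^L} ≤ exp(-e^{ζ₂ℓ})` and
`B (ρτ)^L ≤ e^{-ζ₁ℓ}` ("choose `0 < r < 1` such that `r log(d-1) - C₂(1-r) < r log(5/4)` …").
[cite: Sly2010, §4 (proof of Lemma 4.2, choice of `r`, `ζ₁`, `ζ₂`)] -/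
theorem lemma42_parameters (q : ℕ) {κ₀ ρ A B : ℝ} (hκ₀ : 0 < κ₀) (hκ₁ : κ₀ < 1) (hρ0 : 0 < ρ) (hρ1 : ρ < 1)
    (hA : 0 ≤ A) (hB : 0 ≤ B) :
    ∃ r τ ζ₁ ζ₂ : ℝ, 0 < r ∧ r < 1 ∧ 1 < τ ∧ ρ * τ < 1 ∧ 0 < ζ₁ ∧ 0 < ζ₂ ∧
      ∃ ℓ₀ : ℕ, ∀ ℓ : ℕ, ℓ₀ ≤ ℓ →
        3 ≤ ℓ - ⌊r * ℓ⌋₊ ∧ ⌊r * ℓ⌋₊ ≤ ℓ ∧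
        A * (q : ℝ) ^ ⌊r * ℓ⌋₊ * κ₀ ^ (ℓ - ⌊r * ℓ⌋₊) ≤ 1 ∧
        Real.exp (1 - τ ^ ⌊r * ℓ⌋₊) ≤ Real.exp (-Real.exp (ζ₂ * ℓ)) ∧
        B * (ρ * τ) ^ ⌊r * ℓ⌋₊ ≤ Real.exp (-(ζ₁ * ℓ)) := by
  -- the choice of `r`
  set a : ℝ := Real.log (max (q : ℝ) 1) with ha
  set b : ℝ := -Real.log κ₀ with hb
  have ha0 : 0 ≤ a := Real.log_nonneg (le_max_right _ _)
  have hb0 : 0 < b := by rw [hb, neg_pos]; exact Real.log_neg hκ₀ hκ₁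
  set r : ℝ := b / (2 * (a + b)) with hr
  have hr0 : 0 < r := by positivity
  have hr12 : r ≤ 1 / 2 := by
    rw [hr, div_le_div_iff₀ (by positivity) (by norm_num)]; nlinarith
  have hr1 : r < 1 := by linarith
  -- the choice of `τ`
  set τ : ℝ := (1 + 1 / ρ) / 2 with hτ
  have h1ρ : 1 < 1 / ρ := by rw [lt_div_iff₀ hρ0]; linarith
  have hτ1 : 1 < τ := by rw [hτ]; linarith
  have hρτ : ρ * τ < 1 := by
    rw [hτ, show ρ * ((1 + 1 / ρ) / 2) = (ρ + 1) / 2 by field_simp]; linarith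
  have hρτ0 : 0 < ρ * τ := by positivity
  set ζ₂ : ℝ := r * Real.log τ / 2 with hζ₂
  set ζ₁ : ℝ := r * Real.log (1 / (ρ * τ)) / 2 with hζ₁
  have hlogτ : 0 < Real.log τ := Real.log_pos hτ1
  have hlogρτ : 0 < Real.log (1 / (ρ * τ)) := Real.log_pos (by rw [lt_div_iff₀ hρτ0]; linarith)
  have hζ₂0 : 0 < ζ₂ := by positivity
  have hζ₁0 : 0 < ζ₁ := by positivity
  refine ⟨r, τ, ζ₁, ζ₂, hr0, hr1, hτ1, hρτ, hζ₁0, hζ₂0, ?_⟩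
  -- floor bookkeeping: `rℓ - 1 ≤ L ≤ rℓ`, `K = ℓ - L ≥ (1-r) ℓ`
  have hL : ∀ ℓ : ℕ, (⌊r * ℓ⌋₊ : ℝ) ≤ r * ℓ ∧ r * ℓ - 1 ≤ ⌊r * ℓ⌋₊ ∧ ⌊r * ℓ⌋₊ ≤ ℓ := by
    intro ℓ
    have h0 : 0 ≤ r * ℓ := by positivity
    refine ⟨Nat.floor_le h0, by linarith [Nat.lt_floor_add_one (r * ℓ)], ?_⟩
    have : (⌊r * ℓ⌋₊ : ℝ) ≤ ℓ := (Nat.floor_le h0).trans (by nlinarith)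
    exact_mod_cast this
  -- (1) `K ≥ 3` eventually: `K ≥ (1-r)ℓ ≥ ℓ/2`
  have ev1 : ∀ᶠ ℓ : ℕ in atTop, 3 ≤ ℓ - ⌊r * ℓ⌋₊ := by
    filter_upwards [eventually_ge_atTop 6] with ℓ hℓ
    have h := (hL ℓ).1
    have hℓR : (6 : ℝ) ≤ ℓ := by exact_mod_cast hℓ
    have : (⌊r * ℓ⌋₊ : ℝ) ≤ ℓ / 2 := h.trans (by nlinarith)
    have h3 : (⌊r * ℓ⌋₊ : ℝ) + 3 ≤ ℓ := by linarith
    have h4 : ⌊r * ℓ⌋₊ + 3 ≤ ℓ := by exact_mod_cast h3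
    omega
  -- (2) `A q^L κ₀^K ≤ 1` eventually: `q^L κ₀^K ≤ exp(a r ℓ - b (1-r) ℓ) = exp(-γ ℓ)`
  have hγ : 0 < b * (1 - r) - a * r := by
    have h1 : b * (1 - r) ≥ b / 2 := by nlinarith
    have h2 : a * r = a * b / (2 * (a + b)) := by rw [hr]; ring
    have h3 : a * b / (2 * (a + b)) < b / 2 := by
      rw [div_lt_div_iff₀ (by positivity) (by norm_num)]; nlinarith
    linarith
  have ev2 : ∀ᶠ ℓ : ℕ in atTop, A * (q : ℝ) ^ ⌊r * ℓ⌋₊ * κ₀ ^ (ℓ - ⌊r * ℓ⌋₊) ≤ 1 := by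
    have hbound : ∀ ℓ : ℕ, (q : ℝ) ^ ⌊r * ℓ⌋₊ * κ₀ ^ (ℓ - ⌊r * ℓ⌋₊) ≤ Real.exp (-(b * (1 - r) - a * r) * ℓ) := by
      intro ℓ
      obtain ⟨h1, -, h3⟩ := hL ℓ
      have hq : (q : ℝ) ^ ⌊r * ℓ⌋₊ ≤ Real.exp (a * (r * ℓ)) := by
        calc (q : ℝ) ^ ⌊r * ℓ⌋₊ ≤ (max (q : ℝ) 1) ^ ⌊r * ℓ⌋₊ := pow_le_pow_left₀ (Nat.cast_nonneg _) (le_max_left _ _) _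
          _ = Real.exp (a * ⌊r * ℓ⌋₊) := by
              rw [ha, ← Real.exp_log (lt_max_of_lt_right one_pos : (0:ℝ) < max (q : ℝ) 1), ← Real.exp_nat_mul,
                Real.exp_log (lt_max_of_lt_right one_pos)]; ring_nf
          _ ≤ Real.exp (a * (r * ℓ)) := Real.exp_le_exp.2 (mul_le_mul_of_nonneg_left h1 ha0)
      have hκ : κ₀ ^ (ℓ - ⌊r * ℓ⌋₊) ≤ Real.exp (-(b * ((1 - r) * ℓ))) := by
        have hK : (1 - r) * ℓ ≤ ((ℓ - ⌊r * ℓ⌋₊ : ℕ) : ℝ) := by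
          rw [Nat.cast_sub h3]; linarith
        calc κ₀ ^ (ℓ - ⌊r * ℓ⌋₊) = Real.exp (-(b * ((ℓ - ⌊r * ℓ⌋₊ : ℕ) : ℝ))) := by
              rw [hb, neg_mul, neg_neg, ← Real.exp_log hκ₀, ← Real.exp_nat_mul, Real.exp_log hκ₀]; ring_nf
          _ ≤ Real.exp (-(b * ((1 - r) * ℓ))) := Real.exp_le_exp.2 (by nlinarith)
      calc (q : ℝ) ^ ⌊r * ℓ⌋₊ * κ₀ ^ (ℓ - ⌊r * ℓ⌋₊)
          ≤ Real.exp (a * (r * ℓ)) * Real.exp (-(b * ((1 - r) * ℓ))) :=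
            mul_le_mul hq hκ (pow_nonneg hκ₀.le _) (Real.exp_pos _).le
        _ = Real.exp (-(b * (1 - r) - a * r) * ℓ) := by rw [← Real.exp_add]; ring_nf
    have hlim : Tendsto (fun ℓ : ℕ => A * Real.exp (-(b * (1 - r) - a * r) * ℓ)) atTop (𝓝 (A * 0)) := by
      refine tendsto_const_nhds.mul ?_
      have := (Real.tendsto_exp_neg_atTop_nhds_zero.comp ((tendsto_natCast_atTop_atTop (R := ℝ)).const_mul_atTop hγ))
      refine this.congr fun ℓ => ?_
      simp only [Function.comp]; ring_nf
    rw [mul_zero] at hlim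
    filter_upwards [hlim.eventually (ge_mem_nhds one_pos)] with ℓ hℓ
    calc A * (q : ℝ) ^ ⌊r * ℓ⌋₊ * κ₀ ^ (ℓ - ⌊r * ℓ⌋₊) = A * ((q : ℝ) ^ ⌊r * ℓ⌋₊ * κ₀ ^ (ℓ - ⌊r * ℓ⌋₊)) := by ring
      _ ≤ A * Real.exp (-(b * (1 - r) - a * r) * ℓ) := mul_le_mul_of_nonneg_left (hbound ℓ) hA
      _ ≤ 1 := hℓ
  -- (3) `exp(1 - τ^L) ≤ exp(-exp(ζ₂ ℓ))` eventually: `τ^L ≥ exp(2 ζ₂ ℓ)/τ`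
  have ev3 : ∀ᶠ ℓ : ℕ in atTop, Real.exp (1 - τ ^ ⌊r * ℓ⌋₊) ≤ Real.exp (-Real.exp (ζ₂ * ℓ)) := by
    -- `exp(ζ₂ ℓ) (exp(ζ₂ ℓ)/τ - 1) ≥ 1` eventually
    have hlim : Tendsto (fun ℓ : ℕ => Real.exp (ζ₂ * ℓ) / τ - 1) atTop atTop := by
      have h := (Real.tendsto_exp_atTop.comp ((tendsto_natCast_atTop_atTop (R := ℝ)).const_mul_atTop hζ₂0))
      have h2 : Tendsto (fun ℓ : ℕ => Real.exp (ζ₂ * ℓ) / τ) atTop atTop := (h.atTop_div_const (by linarith))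
      exact tendsto_atTop_add_const_right _ _ h2
    filter_upwards [hlim.eventually (eventually_ge_atTop 1), eventually_ge_atTop 1] with ℓ hℓ hℓ1
    rw [Real.exp_le_exp]
    obtain ⟨-, h2, -⟩ := hL ℓ
    have hE : 1 ≤ Real.exp (ζ₂ * ℓ) := Real.one_le_exp (by positivity)
    -- `τ^L ≥ τ^{rℓ - 1} = exp(2ζ₂ℓ)/τ`
    have hτL : Real.exp (ζ₂ * ℓ) * (Real.exp (ζ₂ * ℓ) / τ) ≤ τ ^ ⌊r * ℓ⌋₊ := by
      have e1 : Real.exp (ζ₂ * ℓ) * (Real.exp (ζ₂ * ℓ) / τ) = Real.exp ((r * ℓ - 1) * Real.log τ) := by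
        rw [sub_mul, one_mul, Real.exp_sub, Real.exp_log (by linarith : 0 < τ), mul_div_assoc', ← Real.exp_add]
        congr 1; congr 1; rw [hζ₂]; ring
      rw [e1, ← Real.rpow_natCast, Real.rpow_def_of_pos (by linarith)]
      exact Real.exp_le_exp.2 (by rw [mul_comm]; exact mul_le_mul_of_nonneg_left h2 hlogτ.le)
    nlinarith [hτL, hE, hℓ]
  -- (4) `B (ρτ)^L ≤ exp(-ζ₁ ℓ)` eventually
  have ev4 : ∀ᶠ ℓ : ℕ in atTop, B * (ρ * τ) ^ ⌊r * ℓ⌋₊ ≤ Real.exp (-(ζ₁ * ℓ)) := by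
    have hlim : Tendsto (fun ℓ : ℕ => Real.exp (ζ₁ * ℓ)) atTop atTop :=
      Real.tendsto_exp_atTop.comp ((tendsto_natCast_atTop_atTop (R := ℝ)).const_mul_atTop hζ₁0)
    filter_upwards [hlim.eventually (eventually_ge_atTop (B / (ρ * τ)))] with ℓ hℓ
    obtain ⟨-, h2, -⟩ := hL ℓ
    -- `(ρτ)^L ≤ (ρτ)^{rℓ-1} = exp(-2ζ₁ℓ)/(ρτ)`
    have hpow : (ρ * τ) ^ ⌊r * ℓ⌋₊ ≤ Real.exp (-(2 * ζ₁ * ℓ)) / (ρ * τ) := by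
      have e1 : Real.exp (-(2 * ζ₁ * ℓ)) / (ρ * τ) = Real.exp ((r * ℓ - 1) * Real.log (ρ * τ)) := by
        rw [sub_mul, one_mul, Real.exp_sub, Real.exp_log hρτ0]
        congr 1; congr 1; rw [hζ₁, one_div, Real.log_inv]; ring
      rw [e1, ← Real.rpow_natCast, Real.rpow_def_of_pos hρτ0]
      refine Real.exp_le_exp.2 ?_
      have hneg : Real.log (ρ * τ) < 0 := Real.log_neg hρτ0 hρτ
      nlinarith
    have hE0 : 0 < Real.exp (ζ₁ * ℓ) := Real.exp_pos _
    calc B * (ρ * τ) ^ ⌊r * ℓ⌋₊ ≤ B * (Real.exp (-(2 * ζ₁ * ℓ)) / (ρ * τ)) := mul_le_mul_of_nonneg_left hpow hB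
      _ = B / (ρ * τ) * (Real.exp (-(ζ₁ * ℓ)) * Real.exp (-(ζ₁ * ℓ))) := by rw [← Real.exp_add]; ring_nf
      _ ≤ Real.exp (ζ₁ * ℓ) * (Real.exp (-(ζ₁ * ℓ)) * Real.exp (-(ζ₁ * ℓ))) :=
          mul_le_mul_of_nonneg_right hℓ (by positivity)
      _ = Real.exp (-(ζ₁ * ℓ)) := by rw [← Real.exp_add, ← Real.exp_add]; ring_nf
  obtain ⟨ℓ₀, hℓ₀⟩ := eventually_atTop.1 (ev1.and (ev2.and (ev3.and ev4)))
  exact ⟨ℓ₀, fun ℓ hℓ => let ⟨h1, h2, h3, h4⟩ := hℓ₀ ℓ hℓ; ⟨h1, (hL ℓ).2.2, h2, h3, h4⟩⟩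

end Asymptotics

section Lemma42Helpers

variable {w : ℝ}

/-- `φ(y) > 0` for `y < 1` and `λ > 0`. [folklore] -/
theorem hcPhi_pos (hlam : 0 < lam) {y : ℝ} (hy : y < 1) : 0 < hcPhi q lam y := by
  rw [hcPhi_eq]
  have : 0 < lam * (1 - y) ^ q := mul_pos hlam (pow_pos (by linarith) _)
  exact div_pos this (by linarith)

/-- `M_k ≤ λ/(1+λ)` for `k ≥ 1`. [folklore] -/
theorem hcM_le_of_one_le (hlam : 0 ≤ lam) {k : ℕ} (hk : 1 ≤ k) : hcM q lam k ≤ lam / (1 + lam) := by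
  obtain ⟨j, rfl⟩ : ∃ j, k = j + 1 := ⟨k - 1, by omega⟩
  rw [hcM_succ]
  have hmj := hcm_le_hcM_mem (q := q) hlam j
  have h := hcPhi_antitone (q := q) hlam hmj.1 (hmj.2.1.trans hmj.2.2)
  refine h.trans (le_of_eq ?_)
  rw [hcPhi_eq]; simp

/-- `M_k < 1` for `k ≥ 1` (`λ ≥ 0`). [folklore] -/
theorem hcM_lt_one (hlam : 0 ≤ lam) {k : ℕ} (hk : 1 ≤ k) : hcM q lam k < 1 :=
  (hcM_le_of_one_le hlam hk).trans_lt (by rw [div_lt_one (by linarith)]; linarith)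

/-- `m_k > 0` for `k ≥ 2` and `λ > 0`. [folklore] -/
theorem hcm_pos (hlam : 0 < lam) {k : ℕ} (hk : 2 ≤ k) : 0 < hcm q lam k := by
  obtain ⟨j, rfl⟩ : ∃ j, k = j + 1 := ⟨k - 1, by omega⟩
  rw [hcm_succ]
  exact hcPhi_pos hlam (hcM_lt_one hlam.le (by omega))

/-- The lower envelope increases along each parity: `m_k ≤ m_{k+2i}`. [folklore] -/
theorem hcm_le_add (hlam : 0 ≤ lam) (k : ℕ) : ∀ i, hcm q lam k ≤ hcm q lam (k + 2 * i)
  | 0 => by simp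
  | i + 1 => (hcm_le_add hlam k i).trans (by
      rw [show k + 2 * (i + 1) = k + 2 * i + 2 by ring]; exact (hcEnv_monotone hlam _).2)

/-- `m_K ≥ min(m_2, m_3)` for `K ≥ 2`. [folklore] -/
theorem min_hcm_le (hlam : 0 ≤ lam) {K : ℕ} (hK : 2 ≤ K) :
    min (hcm q lam 2) (hcm q lam 3) ≤ hcm q lam K := by
  obtain ⟨j, rfl | rfl⟩ := Nat.even_or_odd' K
  · have h := hcm_le_add (q := q) hlam 2 (j - 1)
    rw [show 2 + 2 * (j - 1) = 2 * j by omega] at h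
    exact (min_le_left _ _).trans h
  · have h := hcm_le_add (q := q) hlam 3 (j - 1)
    rw [show 3 + 2 * (j - 1) = 2 * j + 1 by omega] at h
    exact (min_le_right _ _).trans h

/-- **The decay of `E_ν|X_K - R_K|` at the cycle fugacities**: with `C, κ` from `hcEnv_geometric`,
for `R_0 = w/(1+w) ∈ {q⁺, q⁻}` and every `K = 2j` or `2j+1`,
`E_ν|X_K - R_K| ≤ 2 (1 + λq) C κ^j`. [cite: Sly2010, §4 (eq. (e:treeReconDecay2))] -/
theorem hcTreeX_meanAbsDev_decay {d : ℕ} {lam : ℝ} (hlam : 0 < lam) {qp qm : ℝ}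
    (hqm : 0 < qm) (hlt : qm < qp) (hqp1 : qp < 1) (hp : qp = hcPhi (d - 1) lam qm)
    (hm : qm = hcPhi (d - 1) lam qp) (hw : 0 ≤ w) (hwc : w / (1 + w) = qp ∨ w / (1 + w) = qm)
    {C κ : ℝ} (hC : ∀ j : ℕ, hcM (d - 1) lam (2 * j) - qp ≤ C * κ ^ j ∧ qm - hcm (d - 1) lam (2 * j) ≤ C * κ ^ j)
    (j : ℕ) (K : ℕ) (hK : K = 2 * j ∨ K = 2 * j + 1) :
    (∑ A : Fin ((d - 1) ^ K) → Bool, w ^ hcLeafCount A * hcTreeZtot (d - 1) lam K A *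
        |hcTreeX (d - 1) lam K A - (hcPhi (d - 1) lam)^[K] (w / (1 + w))|) /
        (hcGen (d - 1) lam w K false + hcGen (d - 1) lam w K true) ≤
      2 * (1 + lam * (d - 1 : ℕ)) * (C * κ ^ j) := by
  set q := d - 1 with hq
  have hcyc_p : hcPhi q lam (hcPhi q lam qp) = qp := by rw [← hm, ← hp]
  have hcyc_m : hcPhi q lam (hcPhi q lam qm) = qm := by rw [← hp, ← hm]
  have hup := hcTreeX_meanAbsDev_le (q := q) hlam.le hw K
  have hlow := hcTreeX_meanAbsDev_le' (q := q) hlam.le hw K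
  have henc := hcEnv_encloses (q := q) hlam.le hqm.le hqp1.le hp hm (2 * j)
  have hCj : 0 ≤ C * κ ^ j := le_trans (by linarith [henc.2]) (hC j).1
  have hlq : 0 ≤ lam * (q : ℝ) := mul_nonneg hlam.le (Nat.cast_nonneg _)
  have hmem := hcm_le_hcM_mem (q := q) hlam.le (2 * j)
  -- one `φ`-step transfers the even-index decay to the odd indices
  have hodd1 : hcM q lam (2 * j + 1) - qp ≤ lam * q * (C * κ ^ j) := by
    have h := hcPhi_lipschitz (q := q) hlam.le (y := hcm q lam (2 * j)) (y' := qm)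
      ⟨hmem.1, hmem.2.1.trans hmem.2.2⟩ ⟨hqm.le, by linarith⟩
    have habs : |hcm q lam (2 * j) - qm| = qm - hcm q lam (2 * j) := by
      rw [abs_sub_comm]; exact abs_of_nonneg (by linarith [henc.1])
    rw [habs] at h
    calc hcM q lam (2 * j + 1) - qp = hcPhi q lam (hcm q lam (2 * j)) - hcPhi q lam qm := by rw [hcM_succ, ← hp]
      _ ≤ |hcPhi q lam (hcm q lam (2 * j)) - hcPhi q lam qm| := le_abs_self _
      _ ≤ lam * q * (qm - hcm q lam (2 * j)) := h
      _ ≤ lam * q * (C * κ ^ j) := mul_le_mul_of_nonneg_left (hC j).2 hlq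
  have hodd2 : qm - hcm q lam (2 * j + 1) ≤ lam * q * (C * κ ^ j) := by
    have h := hcPhi_lipschitz (q := q) hlam.le (y := qp) (y' := hcM q lam (2 * j)) ⟨by linarith, hqp1.le⟩
      ⟨hmem.1.trans hmem.2.1, hmem.2.2⟩
    have habs : |qp - hcM q lam (2 * j)| = hcM q lam (2 * j) - qp := by
      rw [abs_sub_comm]; exact abs_of_nonneg (by linarith [henc.2])
    rw [habs] at h
    calc qm - hcm q lam (2 * j + 1) = hcPhi q lam qp - hcPhi q lam (hcM q lam (2 * j)) := by rw [hcm_succ, ← hm]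
      _ ≤ |hcPhi q lam qp - hcPhi q lam (hcM q lam (2 * j))| := le_abs_self _
      _ ≤ lam * q * (hcM q lam (2 * j) - qp) := h
      _ ≤ lam * q * (C * κ ^ j) := mul_le_mul_of_nonneg_left (hC j).1 hlq
  rcases hwc with hR | hR <;> rcases hK with rfl | rfl
  · -- `R_0 = q⁺`, `K = 2j`: `R_K = q⁺`, upper envelope
    rw [hR, (iterate_two_cycle hcyc_p j).1] at hup ⊢
    refine hup.trans ?_
    nlinarith [(hC j).1, hCj, hlq]
  · -- `R_0 = q⁺`, `K = 2j+1`: `R_K = q⁻`, lower envelope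
    rw [hR, (iterate_two_cycle hcyc_p j).2, ← hm] at hlow ⊢
    refine hlow.trans ?_
    nlinarith [hodd2, hCj, hlq]
  · -- `R_0 = q⁻`, `K = 2j`: lower envelope
    rw [hR, (iterate_two_cycle hcyc_m j).1] at hlow ⊢
    refine hlow.trans ?_
    nlinarith [(hC j).2, hCj, hlq]
  · -- `R_0 = q⁻`, `K = 2j+1`: `R_K = q⁺`, upper envelope
    rw [hR, (iterate_two_cycle hcyc_m j).2, ← hp] at hup ⊢
    refine hup.trans ?_
    nlinarith [hodd1, hCj, hlq]

end Lemma42Helpers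

section Lemma42

variable {w : ℝ}

/-- `(1 + x)^n ≤ e^{n x}` for `x ≥ 0`. [folklore] -/
theorem one_add_pow_le_exp_mul {x : ℝ} (hx : 0 ≤ x) (n : ℕ) : (1 + x) ^ n ≤ Real.exp (n * x) := by
  calc (1 + x) ^ n ≤ (Real.exp x) ^ n := pow_le_pow_left₀ (by linarith) (by linarith [Real.add_one_le_exp x]) n
    _ = Real.exp (n * x) := by rw [← Real.exp_nat_mul]

/-- Lemma 4.2 at depth `K + L` with the parameters instantiated (the book-keeping step). [cite: Sly2010, Lemma 4.2 (proof)] -/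
theorem sly_lemma42_aux {d : ℕ} {lam : ℝ} (hlam : 0 < lam) {qp qm : ℝ} (hqm : 0 < qm)
    (hlt : qm < qp) (hqp1 : qp < 1) (hp : qp = hcPhi (d - 1) lam qm) (hm : qm = hcPhi (d - 1) lam qp)
    (hw : 0 ≤ w) (hwc : w / (1 + w) = qp ∨ w / (1 + w) = qm)
    {C κ : ℝ} (hC0 : 0 ≤ C) (hκ0 : 0 < κ) (hκ1 : κ < 1)
    (hC : ∀ j : ℕ, hcM (d - 1) lam (2 * j) - qp ≤ C * κ ^ j ∧ qm - hcm (d - 1) lam (2 * j) ≤ C * κ ^ j)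
    {τ ζ₁ ζ₂ : ℝ} (K L : ℕ) (hK : 3 ≤ K)
    (hAq : (Real.exp 1 - 1) * (2 * (1 + lam * (d - 1 : ℕ)) * C / Real.sqrt κ) / min qm (1 - qp) *
      ((d - 1 : ℕ) : ℝ) ^ L * Real.sqrt κ ^ K ≤ 1)
    (h3 : Real.exp (1 - τ ^ L) ≤ Real.exp (-Real.exp (ζ₂ * ((K + L : ℕ) : ℝ))))
    (h4 : 1 / 2 * (1 / min (hcm (d - 1) lam 2) (hcm (d - 1) lam 3) + 1 / (1 - lam / (1 + lam))) *
      (max (lam / (1 + lam)) (lam / (1 + lam)) * τ) ^ L ≤ Real.exp (-(ζ₁ * ((K + L : ℕ) : ℝ)))) :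
    (∑ A : Fin ((d - 1) ^ (K + L)) → Bool,
        if Real.exp (-(ζ₁ * ((K + L : ℕ) : ℝ))) ≤
            |hcTreeX (d - 1) lam (K + L) A - (hcPhi (d - 1) lam)^[K + L] (w / (1 + w))| then
          w ^ hcLeafCount A * hcTreeZtot (d - 1) lam (K + L) A else 0) /
        (hcGen (d - 1) lam w (K + L) false + hcGen (d - 1) lam w (K + L) true) ≤
      Real.exp (-Real.exp (ζ₂ * ((K + L : ℕ) : ℝ))) := by
  set q := d - 1 with hq
  -- the parameters of `hcConc_main`
  set lo := min (hcm q lam 2) (hcm q lam 3) with hlo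
  set hi := lam / (1 + lam) with hhi
  set p := min qm (1 - qp) with hpdef
  set T := τ ^ L with hT
  have hlo0 : 0 < lo := lt_min (hcm_pos hlam le_rfl) (hcm_pos hlam (by norm_num))
  have hhi1 : hi < 1 := by rw [hhi, div_lt_one (by linarith)]; linarith
  have hmlo : lo ≤ hcm q lam K := min_hcm_le hlam.le (by omega)
  have hMhi : hcM q lam K ≤ hi := hcM_le_of_one_le hlam.le (by omega)
  have hp0 : 0 < p := lt_min hqm (by linarith)
  set R := (hcPhi q lam)^[K] (w / (1 + w)) with hR
  have hRmem : R = qp ∨ R = qm := by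
    have hcyc_p : hcPhi q lam (hcPhi q lam qp) = qp := by rw [← hm, ← hp]
    have hcyc_m : hcPhi q lam (hcPhi q lam qm) = qm := by rw [← hp, ← hm]
    obtain ⟨j, hj | hj⟩ := Nat.even_or_odd' K <;> rcases hwc with h | h <;> rw [hR, h, hj]
    · exact Or.inl (iterate_two_cycle hcyc_p j).1
    · exact Or.inr (iterate_two_cycle hcyc_m j).1
    · right; rw [(iterate_two_cycle hcyc_p j).2, ← hm]
    · left; rw [(iterate_two_cycle hcyc_m j).2, ← hp]
  have hpR : p ≤ R := by
    rcases hRmem with h | h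
    · rw [h]; exact (min_le_left _ _).trans hlt.le
    · rw [h]; exact min_le_left _ _
  have hpR' : p ≤ 1 - R := by
    rcases hRmem with h | h
    · rw [h]; exact min_le_right _ _
    · rw [h]; exact (min_le_right _ _).trans (by linarith)
  have hmain := hcConc_main (q := q) (w := w) hlam hw K L hlo0 hhi1 hmlo hMhi zero_le_one le_rfl hp0 hpR hpR' (T := T)
  -- the deviation decay at height `K`
  obtain ⟨j, hj⟩ := Nat.even_or_odd' K
  have hdec := hcTreeX_meanAbsDev_decay hlam hqm hlt hqp1 hp hm hw hwc hC j K hj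
  -- `κ^j ≤ √κ^K / √κ`
  have hsκ0 : 0 < Real.sqrt κ := Real.sqrt_pos.2 hκ0
  have hsκ1 : Real.sqrt κ < 1 := by
    rw [show (1:ℝ) = Real.sqrt 1 from Real.sqrt_one.symm]; exact Real.sqrt_lt_sqrt hκ0.le hκ1
  have hκj : κ ^ j ≤ Real.sqrt κ ^ K / Real.sqrt κ := by
    have e : κ ^ j = Real.sqrt κ ^ (2 * j) := by rw [pow_mul, Real.sq_sqrt hκ0.le]
    rw [le_div_iff₀ hsκ0, e, ← pow_succ]
    exact pow_le_pow_of_le_one hsκ0.le hsκ1.le (by rcases hj with rfl | rfl <;> omega)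
  -- the mean-abs-deviation quotient is at most `A₁ √κ^K`
  set ED := (∑ B : Fin (q ^ K) → Bool, w ^ hcLeafCount B * hcTreeZtot q lam K B * |hcTreeX q lam K B - R|) /
    (hcGen q lam w K false + hcGen q lam w K true) with hEDdef
  have hED : ED ≤ 2 * (1 + lam * (q : ℕ)) * C / Real.sqrt κ * Real.sqrt κ ^ K := by
    refine hdec.trans ?_
    have h0 : 0 ≤ 2 * (1 + lam * (q : ℕ)) * C := by positivity
    calc 2 * (1 + lam * (q : ℕ)) * (C * κ ^ j) = 2 * (1 + lam * (q : ℕ)) * C * κ ^ j := by ring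
      _ ≤ 2 * (1 + lam * (q : ℕ)) * C * (Real.sqrt κ ^ K / Real.sqrt κ) := mul_le_mul_of_nonneg_left hκj h0
      _ = _ := by ring
  -- hence `(1 + (e-1) ED/p)^{q^L} ≤ e`
  have he1 : 0 ≤ Real.exp 1 - 1 := by linarith [Real.add_one_le_exp 1]
  have hED0 : 0 ≤ ED := by
    rw [hEDdef]
    exact div_nonneg (Finset.sum_nonneg fun B _ => mul_nonneg (mul_nonneg (pow_nonneg hw _)
      (hcTreeZtot_pos hlam.le K B).le) (abs_nonneg _)) (hcGen_tot_pos hlam.le hw K).le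
  have hx0 : 0 ≤ (Real.exp 1 - 1) * 1 * ED / p := by positivity
  have hprod : (1 + (Real.exp 1 - 1) * 1 * ED / p) ^ (q ^ L) ≤ Real.exp 1 := by
    refine (one_add_pow_le_exp_mul hx0 _).trans (Real.exp_le_exp.2 ?_)
    push_cast
    calc (q : ℝ) ^ L * ((Real.exp 1 - 1) * 1 * ED / p)
        ≤ (q : ℝ) ^ L * ((Real.exp 1 - 1) * 1 * (2 * (1 + lam * (q : ℕ)) * C / Real.sqrt κ * Real.sqrt κ ^ K) / p) := by
          refine mul_le_mul_of_nonneg_left (div_le_div_of_nonneg_right ?_ hp0.le) (pow_nonneg (Nat.cast_nonneg _) _)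
          exact mul_le_mul_of_nonneg_left hED (by positivity)
      _ = (Real.exp 1 - 1) * (2 * (1 + lam * (q : ℕ)) * C / Real.sqrt κ) / p * (q : ℝ) ^ L * Real.sqrt κ ^ K := by ring
      _ ≤ 1 := hAq
  -- assemble
  have hthr : 1 / 2 * max hi (lam / (1 + lam)) ^ L * (1 / lo + 1 / (1 - hi)) * T ≤
      Real.exp (-(ζ₁ * ((K + L : ℕ) : ℝ))) := by
    refine le_trans (le_of_eq ?_) h4
    rw [hT, mul_pow]; ring
  calc _ ≤ (∑ A : Fin (q ^ (K + L)) → Bool,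
        if 1 / 2 * max hi (lam / (1 + lam)) ^ L * (1 / lo + 1 / (1 - hi)) * T ≤
            |hcTreeX q lam (K + L) A - (hcPhi q lam)^[K + L] (w / (1 + w))| then
          w ^ hcLeafCount A * hcTreeZtot q lam (K + L) A else 0) /
        (hcGen q lam w (K + L) false + hcGen q lam w (K + L) true) := by
        refine div_le_div_of_nonneg_right (Finset.sum_le_sum fun A _ => ?_) (hcGen_tot_pos hlam.le hw (K + L)).le
        have hwZ : 0 ≤ w ^ hcLeafCount A * hcTreeZtot q lam (K + L) A :=
          mul_nonneg (pow_nonneg hw _) (hcTreeZtot_pos hlam.le (K + L) A).le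
        split_ifs with h1 h2
        · exact le_rfl
        · exact absurd (hthr.trans h1) h2
        · exact hwZ
        · exact le_rfl
    _ ≤ Real.exp (-(1 * T)) * (1 + (Real.exp 1 - 1) * 1 * ED / p) ^ (q ^ L) := hmain
    _ ≤ Real.exp (-(1 * T)) * Real.exp 1 := mul_le_mul_of_nonneg_left hprod (Real.exp_pos _).le
    _ = Real.exp (1 - τ ^ L) := by rw [← Real.exp_add, hT]; ring_nf
    _ ≤ _ := h3

/-- **Sly's Lemma 4.2, for every `λ > λ_c(𝕋_d)`** (finite form): for `d ≥ 3`, `λ > 0`, the two-cycle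
`0 < q⁻ < q⁺ < 1` of `φ`, and the i.i.d. boundary field whose fugacity `w` has `w/(1+w) ∈ {q⁺, q⁻}`
(the projections of `μ̂^{±}`), there are `ζ₁, ζ₂ > 0` such that for all large `ℓ`
`ν_ℓ{A : |X_ℓ(A) - R_ℓ| ≥ e^{-ζ₁ℓ}} ≤ exp(-e^{ζ₂ℓ})`, `R_ℓ = φ^ℓ(w/(1+w)) ∈ {q⁺, q⁻}` — Sly's
"`P(|X_{ρ,ℓ,s} - q^s| ≥ exp(-ζ₁ℓ)) ≤ exp(-exp(ζ₂ℓ))`", here without his extra conditions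
`q⁺ ≤ 3/5`, `(d-1)q⁺q⁻ < 1` (logit contraction and strict attraction of the two-cycle instead).
[cite: Sly2010, Lemma 4.2] -/
theorem sly_lemma42 {d : ℕ} (hd : 3 ≤ d) {lam : ℝ} (hlam : 0 < lam) {qp qm : ℝ} (hqm : 0 < qm)
    (hlt : qm < qp) (hqp1 : qp < 1) (hp : qp = hcPhi (d - 1) lam qm) (hm : qm = hcPhi (d - 1) lam qp)
    (hw : 0 ≤ w) (hwc : w / (1 + w) = qp ∨ w / (1 + w) = qm) :
    ∃ ζ₁ ζ₂ : ℝ, 0 < ζ₁ ∧ 0 < ζ₂ ∧ ∃ ℓ₀ : ℕ, ∀ ℓ : ℕ, ℓ₀ ≤ ℓ →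
      (∑ A : Fin ((d - 1) ^ ℓ) → Bool,
          if Real.exp (-(ζ₁ * ℓ)) ≤ |hcTreeX (d - 1) lam ℓ A - (hcPhi (d - 1) lam)^[ℓ] (w / (1 + w))| then
            w ^ hcLeafCount A * hcTreeZtot (d - 1) lam ℓ A else 0) /
          (hcGen (d - 1) lam w ℓ false + hcGen (d - 1) lam w ℓ true) ≤
        Real.exp (-Real.exp (ζ₂ * ℓ)) := by
  obtain ⟨C, κ, hC0, hκ0, hκ1, hC⟩ := hcEnv_geometric hd hlam hqm hlt hqp1 hp hm
  have hsκ0 : 0 < Real.sqrt κ := Real.sqrt_pos.2 hκ0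
  have hsκ1 : Real.sqrt κ < 1 := by
    rw [show (1:ℝ) = Real.sqrt 1 from Real.sqrt_one.symm]; exact Real.sqrt_lt_sqrt hκ0.le hκ1
  have hρ0 : 0 < lam / (1 + lam) := by positivity
  have hρ1 : lam / (1 + lam) < 1 := by rw [div_lt_one (by linarith)]; linarith
  have hlo0 : 0 < min (hcm (d - 1) lam 2) (hcm (d - 1) lam 3) := lt_min (hcm_pos hlam le_rfl) (hcm_pos hlam (by norm_num))
  have hp0 : 0 < min qm (1 - qp) := lt_min hqm (by linarith)
  have he1 : 0 ≤ Real.exp 1 - 1 := by linarith [Real.add_one_le_exp 1]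
  have h1hi : 0 < 1 - lam / (1 + lam) := by linarith
  obtain ⟨r, τ, ζ₁, ζ₂, hr0, hr1, hτ1, hρτ, hζ₁, hζ₂, ℓ₀, hℓ₀⟩ := lemma42_parameters (d - 1)
    (κ₀ := Real.sqrt κ) (ρ := lam / (1 + lam)) hsκ0 hsκ1 hρ0 hρ1
    (A := (Real.exp 1 - 1) * (2 * (1 + lam * (d - 1 : ℕ)) * C / Real.sqrt κ) / min qm (1 - qp))
    (B := 1 / 2 * (1 / min (hcm (d - 1) lam 2) (hcm (d - 1) lam 3) + 1 / (1 - lam / (1 + lam))))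
    (by positivity) (by positivity)
  refine ⟨ζ₁, ζ₂, hζ₁, hζ₂, ℓ₀, fun ℓ hℓ => ?_⟩
  obtain ⟨hK3, hLle, hAq, h3, h4⟩ := hℓ₀ ℓ hℓ
  have hKL : ℓ - ⌊r * ℓ⌋₊ + ⌊r * ℓ⌋₊ = ℓ := Nat.sub_add_cancel hLle
  have haux := sly_lemma42_aux hlam hqm hlt hqp1 hp hm hw hwc hC0 hκ0 hκ1 hC (τ := τ) (ζ₁ := ζ₁) (ζ₂ := ζ₂)
    (ℓ - ⌊r * ℓ⌋₊) ⌊r * ℓ⌋₊ hK3 hAq (by rw [hKL]; exact h3) (by rw [hKL, max_self]; exact h4)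
  rw [hKL] at haux
  exact haux

end Lemma42

end TreeRecursionConc

end Literature.Computability.Complexity
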